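import Literature.NumberTheory.LFunctions.Zhang2022.Section5Lemma58
import Literature.NumberTheory.LFunctions.Zhang2022.Section8MainTerms
import Literature.NumberTheory.LFunctions.RieszMeanInvDedekindZeta
import Literature.NumberTheory.LFunctions.RichertBoundsFromExpSum
import Literature.NumberTheory.LFunctions.ZetaClassicalRegionBounds
import Literature.Analysis.Complex.VerticalLineShiftPoles
import Mathlib.Analysis.SpecialFunctions.JapaneseBracket
import HarnessLib

/-!
# Zhang (2022), Lemma 8.2: the twisted logarithmic mean `∑_{m<x} χ(m)m^{β_j−1}(x/m)^{β_μ}log(x/m)`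
# `= L′(1,χ)𝔣_{jμ}(x) + O(𝓛⁻⁶)` under (A), kernel-checked

Topic `Literature/NumberTheory/LFunctions/Zhang2022` (Landau–Siegel autopsy tree; verdict-neutral).
Y. Zhang, *Discrete mean estimates and the Landau–Siegel zero*, arXiv:2211.02515v1 (2022) — **an
unrefereed manuscript, a claimed result under adjudication** — §8, Lemma 8.2 (pp. 16–17):

> **Lemma 8.2.** Suppose `T < x < P`. Then for `μ = 6, 7`,
> `∑_{m<x} χ(m) m^{-(1−β_j)} (x/m)^{β_μ} log(x/m) = L′(1,χ) 𝔣_{jμ}(x) + O(𝓛⁻⁶)`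
> where `𝔣_{jμ}(x) = (1 + (β_μ − β_j) log x) x^{β_μ}`.
> *Proof.* The sum is equal to `(2πi)⁻¹ ∫_{(1)} L(1−β_j+s,χ) x^s ds/(s−β_μ)²`. We move the contour
> of integration to the vertical segments `s = α + it` (`|t| ≥ D`), `s = −𝓛⁻¹ + it` (`|t| ≤ D`) and
> to the two connecting horizontal segments … It follows by Lemma 5.6 that
> `∑_{m<x} … = (2πi)⁻¹ ∮_{|s|=5α} L(1−β_j+s,χ) x^s ds/(s−β_μ)² + O(ε₁)`
> `= L′(1,χ)·(2πi)⁻¹ ∮_{|s|=5α} x^s(s−β_j)(s−β_μ)⁻² ds + O(𝓛⁻⁶)`.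
> The result now follows by direct calculation. □

Here `χ` is the real primitive character mod `D`, `𝓛 = log D` (2.1), `P = exp 𝓛⁹` (2.6),
`α = π/log P = π𝓛⁻⁹` (2.10), `T = exp 𝓛^{1.1}` (§6, before Lemma 6.1), the shifts are
`β₁ = iα(1−5c′α𝓛)`, `β₂ = 2iα(1+c′α𝓛)`, `β₃ = 3iα(1−c′α𝓛)` (2.13) (`c′` the constant fixed in §4),
`β₆ = 3iα/2`, `β₇ = 5iα/2` (2.22), `j ∈ {1,2,3}`, and (A) is `L(1,χ) < 𝓛⁻²⁰²²`.

This file PROVES the lemma, following the printed proof (Perron integral with the double-pole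
kernel, contour shift to `Re = −𝓛⁻¹` past the double pole at `s = β_μ`, evaluation of the residue
by Lemma 5.8), with every `O(·)` made explicit:

* `lemma_8_2` — the printed statement: for `c′ ≥ 0` there is `C = C(c′)` with
  `‖∑_{m≤x} χ(m)m^{β_j−1}(x/m)^{β_μ}log(x/m) − L′(1,χ)𝔣_{jμ}(x)‖ ≤ C𝓛⁻⁶` for `χ` primitive mod `D`,
  `log D ≥ 3`, `8(3+5c′)π ≤ 𝓛⁸` ("`D ≥ D₀(c′)`", the manuscript's standing "`D` large"), (A),
  `β_j ∈ {β₁,β₂,β₃}`, `β_μ ∈ {β₆,β₇}`, `T ≤ x ≤ P` (the main term is `frakf β_j β_μ (log x)` of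
  `Section8MainTerms`, whose `circleIntegral_lemma82` kernel-checks the printed "direct
  calculation" `(2πi)⁻¹∮ x^s(s−β_j)(s−β_μ)⁻²ds = 𝔣_{jμ}`);
* `lemma_8_2_general` — the same for arbitrary purely imaginary shifts `‖β‖, ‖β′‖ ≤ Kα`,
  constant `C82 (2K)`;
* `sum_twist_log_sub_main_le` — the core: with `δ = β_μ − β_j` and `x^{β_μ}` divided out,
  `‖∑_{m≤x} χ(m)m^{−1−δ}log(x/m) − L′(1,χ)(1 + δ log x)‖ ≤ C82(K)·𝓛⁻⁶`;
* `lemma_8_2_varkappa` / `lemma_8_2_varkappa_printed` — the form in which §8 consumes the lemma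
  (the display after Lemma 8.4: "By Lemma 8.2 with `x = P₁/dr` …
  `∑_m χ(m)ϰ₁(drm)/m^{1−β_j} = (L′(1,χ)/log P₁)𝔣_{j6}(P₁/dr) + O(𝓛⁻¹⁵)` if `dr < P₁/T`"), with the
  weights `ϰ_i` of (8.6) (`varkappa`): for any level `P_i ≤ P` and `k = dr` with `kT ≤ P_i`,
  the error is `≤ C82·𝓛⁻⁶/log P_i` (`= O(𝓛⁻¹⁵)` for `log P_i ≍ 𝓛⁹`).

## Proof (the printed architecture, explicit)

1. *Perron* (`sum_eq_integral`): after `s = β_μ + u` the printed integral is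
   `x^{β_μ}·(2πi)⁻¹∫_{(1)} F(u)x^u u⁻² du` with `F(u) = L(1+δ+u,χ) = ∑ χ(m)m^{−1−δ}m^{−u}`
   (`Fδ`, `twist`, `Fδ_eq_LSeries`); the tree's Perron formula for the kernel `1/u²`
   (`LogRieszMean.sum_mul_log_eq_integral_LSeries`, Montgomery–Vaughan (5.21)–(5.22)) gives
   `∑_{m≤x} a(m)log(x/m) = (1/2π)∫ G(1+it)dt`, `G(u) = x^uF(u)/u²`.
2. *Contour shift* (`integral_vertical_sub_eq_sum_of_poles_dslope` of the tree): the whole line is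
   moved to `Re u = −𝓛⁻¹` across the double pole at `u = 0` (residue `φ′(0)`,
   `φ(u) = x^uF(u)`; `residue_eq`: `= (log x)L(1+δ,χ) + L′(1+δ,χ)`). The printed three-piece
   contour (`Re s = α` for `|t| ≥ D`) is replaced by the single line; on it we use the elementary
   bound `‖L(s,χ)‖ ≤ (q(|s|+1))^{1−σ}(4 + log q + log(|s|+1))` for `½ ≤ σ ≤ 1`
   (`norm_LFunction_le_left`: partial summation, MV Thm. 4.8 — no zero-free input; the printed
   "by Lemma 5.6" is not needed), whence `‖G(−𝓛⁻¹+it)‖ ≤ x^{−1/𝓛}(4e/9)𝓛³·h(t)` with the fixed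
   integrable `h(t) = (|t|+3)^{2/3}(1/9+t²)⁻¹` (`norm_G_left_le`), and
   `x^{−1/𝓛}𝓛³ ≤ 90!·𝓛⁻⁶` for `x ≥ T` (`rpow_neg_inv_log_mul_le`: `x^{−1/𝓛} ≤ exp(−𝓛^{0.1})`) —
   the printed `O(ε₁)`. Horizontal decay and the line `Re u = 1` use the crude
   `‖L(s,χ)‖ ≤ q|s|∑n^{−3/2}` and `‖L(2+it,χ)‖ ≤ 2`.
3. *Residue* (`norm_residue_sub_main_le`): `L(1+δ,χ) = L′(1,χ)δ + O(𝓛⁻¹⁵)` is the tree's Lemma 5.8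
   (`Lemma58.lemma_5_8_of_le`, times `log x ≤ 𝓛⁹`), and `L′(1+δ,χ) − L′(1,χ) = O(α𝓛³) = O(𝓛⁻⁶)`
   by Cauchy's estimate applied to `L(z) − L(1) − L′(1)(z−1)` on `|z−(1+δ)| = (K+1)α` with the
   tree's `Lemma58.norm_taylor_two_remainder_le`; together `φ′(0) = L′(1,χ)(1 + δ log x) + O(𝓛⁻⁶)`,
   which is the printed "`= L′(1,χ)·(2πi)⁻¹∮ … + O(𝓛⁻⁶)`" and "direct calculation".

Only definitions of the manuscript are used; nothing about its Theorems 1–2 is stated or implied;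
the cell's verdict (the located failure of (8.24)) is independent of this lemma (STEPS row L8.2,
"shown" by hand; `Section8MainTerms` lists "the contour shifts and error terms `O(𝓛⁻⁶)` of Lemmas
8.2–8.4 under hypothesis (A)" as outside the kernel — this file brings Lemma 8.2's inside). The
hypothesis `χ² = 1` of the manuscript is not needed and not assumed; `T ≤ x ≤ P` (closed) and the
sum over `m ≤ x` (the term `m = x` has `log(x/m) = 0`) only weaken the printed hypotheses.

## References

* Y. Zhang, arXiv:2211.02515v1 (2022), §8 Lemma 8.2; §5 Lemma 5.8; §2 (2.1), (2.6), (2.10),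
  (2.13), (2.22); §6 (`T`). [cite: Zhang2022LandauSiegel, §8, Lemma 8.2]
* H. L. Montgomery, R. C. Vaughan, *Multiplicative Number Theory I*, CUP 2007, §4.3 (4.23),
  Thm. 4.8 (partial summation for `L(s,χ)`); §5.1 (5.21)–(5.22) (Perron for Riesz means).
  [cite: MontgomeryVaughan2007, §4.3 and §5.1]
-/

noncomputable section

open Complex Filter Topology Set Real MeasureTheory

namespace Literature.NumberTheory.LFunctions.Zhang2022.Lemma82

variable {q : ℕ} [NeZero q] (χ : DirichletCharacter ℂ q)

/-! ### §1. `L(s,χ)` just left of `σ = 1`, sublinearly in `t` -/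

omit [NeZero q] in
/-- `∑_{n<N} 1/(n+1) ≤ 1 + log N`. [folklore] -/
theorem sum_inv_le_one_add_log (N : ℕ) :
    ∑ n ∈ Finset.range N, 1 / ((n + 1 : ℕ) : ℝ) ≤ 1 + Real.log N := by
  have h := harmonic_le_one_add_log N
  simp only [harmonic, Rat.cast_sum, Rat.cast_inv, Rat.cast_natCast, one_div] at h ⊢
  exact h

omit [NeZero q] in
/-- **The head** `‖∑_{n ≤ N} χ(n) n^{-s}‖ ≤ N^{1−σ}(1 + log N)` for `σ = Re s ≤ 1`. [folklore] -/
theorem norm_head_le (s : ℂ) (hσ1 : s.re ≤ 1) (N : ℕ) :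
    ‖∑ n ∈ Finset.range N, χ ((n + 1 : ℕ) : ZMod q) * ((n + 1 : ℕ) : ℂ) ^ (-s)‖ ≤
      (N : ℝ) ^ (1 - s.re) * (1 + Real.log N) := by
  have hN0 : (0 : ℝ) ≤ N := Nat.cast_nonneg N
  calc ‖∑ n ∈ Finset.range N, χ ((n + 1 : ℕ) : ZMod q) * ((n + 1 : ℕ) : ℂ) ^ (-s)‖
      ≤ ∑ n ∈ Finset.range N, ‖χ ((n + 1 : ℕ) : ZMod q) * ((n + 1 : ℕ) : ℂ) ^ (-s)‖ :=
        norm_sum_le _ _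
    _ ≤ ∑ n ∈ Finset.range N, (N : ℝ) ^ (1 - s.re) * (1 / ((n + 1 : ℕ) : ℝ)) := by
        refine Finset.sum_le_sum fun n hn => ?_
        have hn1 : (0 : ℝ) < ((n + 1 : ℕ) : ℝ) := by positivity
        have hnN : ((n + 1 : ℕ) : ℝ) ≤ N := by
          exact_mod_cast Nat.succ_le_of_lt (Finset.mem_range.1 hn)
        rw [norm_mul, Complex.norm_natCast_cpow_of_pos (Nat.succ_pos n), neg_re]
        have hχ1 : ‖χ ((n + 1 : ℕ) : ZMod q)‖ ≤ 1 := χ.norm_le_one _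
        have hsplit : ((n + 1 : ℕ) : ℝ) ^ (-s.re) =
            ((n + 1 : ℕ) : ℝ) ^ (1 - s.re) * (1 / ((n + 1 : ℕ) : ℝ)) := by
          rw [show -s.re = (1 - s.re) + (-1) by ring, Real.rpow_add hn1, Real.rpow_neg_one,
            one_div]
        rw [hsplit]
        have hmono : ((n + 1 : ℕ) : ℝ) ^ (1 - s.re) ≤ (N : ℝ) ^ (1 - s.re) :=
          Real.rpow_le_rpow hn1.le hnN (by linarith)
        calc ‖χ ((n + 1 : ℕ) : ZMod q)‖ * (((n + 1 : ℕ) : ℝ) ^ (1 - s.re) * (1 / ((n + 1 : ℕ) : ℝ)))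
            ≤ 1 * ((N : ℝ) ^ (1 - s.re) * (1 / ((n + 1 : ℕ) : ℝ))) := by
              gcongr
          _ = _ := one_mul _
    _ = (N : ℝ) ^ (1 - s.re) * ∑ n ∈ Finset.range N, 1 / ((n + 1 : ℕ) : ℝ) := by
        rw [Finset.mul_sum]
    _ ≤ (N : ℝ) ^ (1 - s.re) * (1 + Real.log N) :=
        mul_le_mul_of_nonneg_left (sum_inv_le_one_add_log N) (by positivity)

/-- **`L(s,χ)` for `½ ≤ σ ≤ 1`, Pólya–Vinogradov not needed**: for `χ ≠ χ₀` mod `q`,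
`‖L(s,χ)‖ ≤ (q(‖s‖+1))^{1−σ} (4 + log q + log(‖s‖+1))` — partial summation
`L(s,χ) = ∑_{n≤N} χ(n)n^{-s} + O(qN^{-σ}(1+|s|/σ))` (MV Thm. 4.8 / (4.23)) with `N = q(⌊|s|⌋+1)`.
On `σ = 1 − 1/log q` this is `≪ (|t|+2)^{1/log q} (log q + log(|t|+2))`, sublinear in `t`.
[cite: MontgomeryVaughan2007, §4.3 (4.23) and Thm. 4.8] -/
theorem norm_LFunction_le_left (hχ : χ ≠ 1) {s : ℂ} (hσ0 : 1 / 2 ≤ s.re) (hσ1 : s.re ≤ 1) :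
    ‖χ.LFunction s‖ ≤
      ((q : ℝ) * (‖s‖ + 1)) ^ (1 - s.re) * (4 + Real.log q + Real.log (‖s‖ + 1)) := by
  have hs0 : 0 < s.re := by linarith
  have hq1 : 1 ≤ q := NeZero.one_le
  have hq0 : (0 : ℝ) < q := by exact_mod_cast NeZero.pos q
  set N : ℕ := q * (⌊‖s‖⌋₊ + 1) with hNdef
  have hN1 : 1 ≤ N := Nat.one_le_iff_ne_zero.2 (Nat.mul_ne_zero (by omega) (by omega))
  have hNR : (N : ℝ) = q * ((⌊‖s‖⌋₊ : ℝ) + 1) := by rw [hNdef]; push_cast; ring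
  have hfl : ‖s‖ < (⌊‖s‖⌋₊ : ℝ) + 1 := Nat.lt_floor_add_one ‖s‖
  have hfl' : (⌊‖s‖⌋₊ : ℝ) ≤ ‖s‖ := Nat.floor_le (norm_nonneg s)
  have hsN : (q : ℝ) * ‖s‖ ≤ N := by rw [hNR]; exact mul_le_mul_of_nonneg_left hfl.le hq0.le
  have hqN : (q : ℝ) ≤ N := by
    rw [hNR]
    have : (1 : ℝ) ≤ (⌊‖s‖⌋₊ : ℝ) + 1 := by have := Nat.cast_nonneg (α := ℝ) ⌊‖s‖⌋₊; linarith
    nlinarith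
  have hN0 : (0 : ℝ) < N := lt_of_lt_of_le hq0 hqN
  have hNle : (N : ℝ) ≤ q * (‖s‖ + 1) := by
    rw [hNR]; exact mul_le_mul_of_nonneg_left (by linarith) hq0.le
  have htail := RichertFromExpSum.norm_LFunction_sub_sum_range_le χ hχ hs0 hN1
  have hhead := norm_head_le χ s hσ1 N
  -- `q N^{-σ}(1 + |s|/σ) ≤ 3 N^{1-σ}`
  have hNpow : (N : ℝ) ^ (-s.re) = (N : ℝ) ^ (1 - s.re) / N := by
    rw [show -s.re = (1 - s.re) + (-1) by ring, Real.rpow_add hN0, Real.rpow_neg_one,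
      div_eq_mul_inv]
  have hpow0 : 0 ≤ (N : ℝ) ^ (1 - s.re) := by positivity
  have htail' : (q : ℝ) * (N : ℝ) ^ (-s.re) * (1 + ‖s‖ / s.re) ≤ 3 * (N : ℝ) ^ (1 - s.re) := by
    rw [hNpow]
    have hinv : 1 / s.re ≤ 2 := by
      rw [div_le_iff₀ hs0]; linarith
    have h1 : ‖s‖ / s.re ≤ 2 * ‖s‖ := by
      rw [div_eq_mul_one_div]
      calc ‖s‖ * (1 / s.re) ≤ ‖s‖ * 2 := mul_le_mul_of_nonneg_left hinv (norm_nonneg s)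
        _ = 2 * ‖s‖ := by ring
    have h2 : (q : ℝ) * (1 + ‖s‖ / s.re) ≤ 3 * N := by
      calc (q : ℝ) * (1 + ‖s‖ / s.re) ≤ (q : ℝ) * (1 + 2 * ‖s‖) := by gcongr
        _ = q + 2 * (q * ‖s‖) := by ring
        _ ≤ N + 2 * N := by linarith
        _ = 3 * N := by ring
    calc (q : ℝ) * ((N : ℝ) ^ (1 - s.re) / N) * (1 + ‖s‖ / s.re)
        = (N : ℝ) ^ (1 - s.re) * ((q : ℝ) * (1 + ‖s‖ / s.re) / N) := by
          field_simp
      _ ≤ (N : ℝ) ^ (1 - s.re) * (3 * N / N) := by gcongr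
      _ = 3 * (N : ℝ) ^ (1 - s.re) := by field_simp
  -- assemble
  have hL : ‖χ.LFunction s‖ ≤ (N : ℝ) ^ (1 - s.re) * (4 + Real.log N) := by
    have := norm_le_norm_add_norm_sub' (χ.LFunction s)
      (∑ n ∈ Finset.range N, χ ((n + 1 : ℕ) : ZMod q) * ((n + 1 : ℕ) : ℂ) ^ (-s))
    calc ‖χ.LFunction s‖ ≤ (N : ℝ) ^ (1 - s.re) * (1 + Real.log N) + 3 * (N : ℝ) ^ (1 - s.re) := by
          linarith
      _ = (N : ℝ) ^ (1 - s.re) * (4 + Real.log N) := by ring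
  have hlogN : Real.log N ≤ Real.log q + Real.log (‖s‖ + 1) := by
    rw [← Real.log_mul hq0.ne' (by positivity)]
    exact Real.log_le_log hN0 hNle
  have hlogN0 : 0 ≤ Real.log N := Real.log_nonneg (by exact_mod_cast hN1)
  have hpowle : (N : ℝ) ^ (1 - s.re) ≤ ((q : ℝ) * (‖s‖ + 1)) ^ (1 - s.re) :=
    Real.rpow_le_rpow hN0.le hNle (by linarith)
  calc ‖χ.LFunction s‖ ≤ (N : ℝ) ^ (1 - s.re) * (4 + Real.log N) := hL
    _ ≤ ((q : ℝ) * (‖s‖ + 1)) ^ (1 - s.re) * (4 + Real.log q + Real.log (‖s‖ + 1)) := by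
        apply mul_le_mul hpowle (by linarith) (by linarith) (by positivity)

/-- `Z_{1/2} = ∑_{n≥1} n^{-3/2}`. [folklore] -/
def Zhalf : ℝ := ∑' n : ℕ, ((n + 1 : ℕ) : ℝ) ^ (-(1 / 2 : ℝ) - 1)

omit [NeZero q] in
/-- `Z_{1/2} ≥ 0`. [folklore] -/
theorem Zhalf_nonneg : 0 ≤ Zhalf := tsum_nonneg fun n => by positivity

/-- The crude bound `‖L(s,χ)‖ ≤ q‖s‖Z_{1/2}` for `Re s ≥ 1/2`, `χ ≠ 1` (Abel summation; the
tree's `DirichletAbel.norm_LFunction_le`). [folklore] -/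
theorem norm_LFunction_le_crude (hχ : χ ≠ 1) {s : ℂ} (hs : 1 / 2 ≤ s.re) :
    ‖χ.LFunction s‖ ≤ q * ‖s‖ * Zhalf := by
  have hs0 : 0 < s.re := by linarith
  refine (DirichletAbel.norm_LFunction_le χ hχ hs0).trans ?_
  have hZ : ∑' n : ℕ, ((n + 1 : ℕ) : ℝ) ^ (-s.re - 1) ≤ Zhalf := by
    refine Summable.tsum_le_tsum (fun n => ?_) (DirichletAbel.summable_rpow_neg hs0)
      (DirichletAbel.summable_rpow_neg (by norm_num))
    exact Real.rpow_le_rpow_of_exponent_le (by exact_mod_cast Nat.le_add_left 1 n) (by linarith)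
  exact mul_le_mul_of_nonneg_left hZ (by positivity)


/-! ### §2. The objects: the twisted coefficients, `F(u) = L(1+δ+u,χ)`, the Perron integrand -/

/-- The coefficients `a(m) = χ(m) m^{−1−δ}` (so that `χ(m)m^{β_j−1}(x/m)^{β_μ} = x^{β_μ} a(m)` with
`δ = β_μ − β_j`). [cite: Zhang2022LandauSiegel, §8, proof of Lemma 8.2] -/
def twist (δ : ℂ) : ℕ → ℂ := fun m => χ (m : ZMod q) * (m : ℂ) ^ (-1 - δ)

/-- `F(u) = L(1 + δ + u, χ)` (the source's `L(1 − β_j + s, χ)` after `s = β_μ + u`).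
[cite: Zhang2022LandauSiegel, §8, proof of Lemma 8.2] -/
def Fδ (δ : ℂ) : ℂ → ℂ := fun u => χ.LFunction (1 + δ + u)

/-- `φ(u) = x^u F(u)`, the numerator at the double pole `u = 0`. [folklore] -/
def phi (δ : ℂ) (x : ℝ) : ℂ → ℂ := fun u => (x : ℂ) ^ u * Fδ χ δ u

/-- The Perron integrand `G(u) = x^u F(u) / u²` (the source's `L(1−β_j+s,χ) x^s (s−β_μ)^{-2}`
after `s = β_μ + u`, up to the factor `x^{β_μ}`). [cite: Zhang2022LandauSiegel, §8, proof of
Lemma 8.2] -/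
def G (δ : ℂ) (x : ℝ) : ℂ → ℂ := fun u => (x : ℂ) ^ u * Fδ χ δ u / u ^ 2

omit [NeZero q] in
/-- Termwise: `a(m) m^{-s} = χ(m) m^{-(s+1+δ)}`. [folklore] -/
theorem term_twist (δ s : ℂ) (m : ℕ) :
    LSeries.term (twist χ δ) s m = LSeries.term (fun n : ℕ => χ (n : ZMod q)) (s + 1 + δ) m := by
  rcases eq_or_ne m 0 with rfl | hm
  · simp [LSeries.term]
  have hm' : (m : ℂ) ≠ 0 := by exact_mod_cast hm
  rw [LSeries.term_of_ne_zero hm, LSeries.term_of_ne_zero hm, twist]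
  have h1 : (m : ℂ) ^ s ≠ 0 := by
    rw [Ne, Complex.cpow_eq_zero_iff]; exact fun h => hm' h.1
  have h2 : (m : ℂ) ^ (1 + δ) ≠ 0 := by
    rw [Ne, Complex.cpow_eq_zero_iff]; exact fun h => hm' h.1
  rw [show s + 1 + δ = s + (1 + δ) by ring, Complex.cpow_add _ _ hm',
    show (-1 - δ : ℂ) = -(1 + δ) by ring, Complex.cpow_neg]
  field_simp

omit [NeZero q] in
/-- `∑ a(m) m^{-s} = ∑ χ(m) m^{-(s+1+δ)}`. [folklore] -/
theorem LSeries_twist (δ s : ℂ) :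
    LSeries (twist χ δ) s = LSeries (fun n : ℕ => χ (n : ZMod q)) (s + 1 + δ) := by
  simp only [LSeries]
  exact tsum_congr fun m => term_twist χ δ s m

omit [NeZero q] in
/-- Absolute convergence of `∑ a(m) m^{-s}` for `Re s > 0` (`δ` purely imaginary). [folklore] -/
theorem LSeriesSummable_twist {δ : ℂ} (hδ : δ.re = 0) {s : ℂ} (hs : 0 < s.re) :
    LSeriesSummable (twist χ δ) s := by
  have h : LSeriesSummable (fun n : ℕ => χ (n : ZMod q)) (s + 1 + δ) :=
    DirichletCharacter.LSeriesSummable_of_one_lt_re χ (by simp [hδ]; linarith)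
  unfold LSeriesSummable at h ⊢
  refine h.congr fun m => (term_twist χ δ s m).symm

/-- `F(u) = ∑ a(m) m^{-u}` for `Re u > 0`. [folklore] -/
theorem Fδ_eq_LSeries {δ : ℂ} (hδ : δ.re = 0) {u : ℂ} (hu : 0 < u.re) :
    Fδ χ δ u = LSeries (twist χ δ) u := by
  rw [LSeries_twist, Fδ]
  have hre : 1 < (1 + δ + u).re := by simp [hδ]; linarith
  rw [DirichletCharacter.LFunction_eq_LSeries χ hre, show u + 1 + δ = 1 + δ + u by ring]

/-- `F` is entire (`χ ≠ 1`). [folklore] -/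
theorem differentiable_Fδ (hχ : χ ≠ 1) (δ : ℂ) : Differentiable ℂ (Fδ χ δ) := fun u =>
  ((DirichletCharacter.differentiable_LFunction hχ) (1 + δ + u)).comp u
    ((differentiableAt_const _).add differentiableAt_id)

/-- `φ` is entire (`x > 0`). [folklore] -/
theorem differentiable_phi (hχ : χ ≠ 1) (δ : ℂ) {x : ℝ} (hx : 0 < x) :
    Differentiable ℂ (phi χ δ x) := fun u => by
  have hx0 : (x : ℂ) ≠ 0 := by exact_mod_cast hx.ne'
  exact (differentiableAt_id.const_cpow (Or.inl hx0)).mul (differentiable_Fδ χ hχ δ u)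

/-- `G` is holomorphic off `u = 0`. [folklore] -/
theorem differentiableAt_G (hχ : χ ≠ 1) (δ : ℂ) {x : ℝ} (hx : 0 < x) {u : ℂ} (hu : u ≠ 0) :
    DifferentiableAt ℂ (G χ δ x) u := by
  have h := (differentiable_phi χ hχ δ hx u).div (differentiableAt_id.pow 2) (pow_ne_zero 2 hu)
  exact h

/-- `G = φ / u²`. [folklore] -/
theorem G_eq_phi_div (δ : ℂ) (x : ℝ) (u : ℂ) : G χ δ x u = phi χ δ x u / (u - 0) ^ (1 + 1) := by
  simp [G, phi, sub_zero]

/-- **Perron's formula for the logarithmic weight** (the source's first display in the proof,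
`∑_{m<x} … = (2πi)^{-1}∫_{(1)} L(1−β_j+s,χ) x^s ds/(s−β_μ)²`, after `s = β_μ + u`):
`∑_{m ≤ x} a(m) log(x/m) = (1/2π) ∫ G(1+it) dt`. [cite: Zhang2022LandauSiegel, §8, proof of Lemma 8.2;
MontgomeryVaughan2007, §5.1 (5.21)–(5.22)] -/
theorem sum_eq_integral {δ : ℂ} (hδ : δ.re = 0) {x : ℝ} (hx : 0 < x) :
    ∑ m ∈ Finset.Ioc 0 ⌊x⌋₊, twist χ δ m * (Real.log (x / m) : ℂ) =
      (1 / (2 * π) : ℂ) * ∫ t : ℝ, G χ δ x (1 + t * I) := by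
  have h := LogRieszMean.sum_mul_log_eq_integral_LSeries (twist χ δ) hx one_pos
    (LSeriesSummable_twist χ hδ (s := 1) (by simp))
  rw [h]
  congr 1
  refine integral_congr_ae (Eventually.of_forall fun t => ?_)
  have hre : 0 < ((1 : ℂ) + t * I).re := by simp
  simp only [G, Complex.ofReal_one]
  rw [Fδ_eq_LSeries χ hδ hre]
  ring


/-! ### §3. Bounds on the lines `Re u = 1`, `Re u = −1/𝓛` and the horizontal decay -/

section Strip

omit [NeZero q] in
/-- `c + it ≠ 0` for `c ≠ 0`. [folklore] -/
theorem line_ne_zero {c : ℝ} (hc : c ≠ 0) (t : ℝ) : (c : ℂ) + t * I ≠ 0 := by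
  intro h
  have := congrArg Complex.re h
  simp at this
  exact hc this

/-- `t ↦ G(c+it)` is continuous for `c ≠ 0`. [folklore] -/
theorem continuous_G_line (hχ : χ ≠ 1) (δ : ℂ) {x : ℝ} (hx : 0 < x) {c : ℝ} (hc : c ≠ 0) :
    Continuous fun t : ℝ => G χ δ x ((c : ℂ) + t * I) := by
  have hline : Continuous fun t : ℝ => (c : ℂ) + t * I := by fun_prop
  have hG : ContinuousOn (G χ δ x) {u : ℂ | u ≠ 0} := fun u hu =>
    (differentiableAt_G χ hχ δ hx hu).continuousAt.continuousWithinAt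
  exact hG.comp_continuous hline fun t => line_ne_zero hc t

/-- **On the line `Re u = 1`**: `‖F(1+it)‖ = ‖L(2+δ+it,χ)‖ ≤ 2` (`δ` purely imaginary). [folklore] -/
theorem norm_Fδ_right_le {δ : ℂ} (hδ : δ.re = 0) (t : ℝ) : ‖Fδ χ δ (((1 : ℝ) : ℂ) + t * I)‖ ≤ 2 := by
  have hre : (1 + δ + (((1 : ℝ) : ℂ) + t * I)).re = 2 := by simp [hδ]; norm_num
  have hre1 : 1 < (1 + δ + (((1 : ℝ) : ℂ) + t * I)).re := by rw [hre]; norm_num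
  rw [Fδ, DirichletCharacter.LFunction_eq_LSeries χ hre1]
  have h := ZetaClassicalRegion.norm_LSeries_le_of_norm_le_one (f := fun n : ℕ => χ (n : ZMod q))
    (fun n => χ.norm_le_one _) hre1
  rw [hre] at h
  norm_num at h
  exact h

/-- Integrability of `G` on the line `Re u = 1`: `‖G(1+it)‖ ≤ 2x/(1+t²)`. [folklore] -/
theorem integrable_G_right (hχ : χ ≠ 1) {δ : ℂ} (hδ : δ.re = 0) {x : ℝ} (hx : 0 < x) :
    Integrable fun t : ℝ => G χ δ x (((1 : ℝ) : ℂ) + t * I) := by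
  have hcont := continuous_G_line χ hχ δ hx (c := 1) one_ne_zero
  refine ((integrable_inv_one_add_sq.const_mul (2 * x)).mono' hcont.aestronglyMeasurable
    (Eventually.of_forall fun t => ?_))
  have hw0 : (((1 : ℝ) : ℂ) + t * I) ≠ 0 := line_ne_zero one_ne_zero t
  have hnsq : ‖((1 : ℝ) : ℂ) + t * I‖ ^ 2 = 1 + t ^ 2 := by
    rw [Complex.sq_norm, Complex.normSq_apply]; simp; ring
  rw [G, norm_div, norm_mul, norm_pow, hnsq, Complex.norm_cpow_eq_rpow_re_of_pos hx]
  have hre : ((((1 : ℝ) : ℂ) + t * I)).re = 1 := by simp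
  rw [hre, Real.rpow_one]
  have hF := norm_Fδ_right_le χ hδ t
  have hpos : 0 < 1 + t ^ 2 := by positivity
  rw [div_le_iff₀ hpos]
  calc x * ‖Fδ χ δ (((1 : ℝ) : ℂ) + t * I)‖ ≤ x * 2 := by gcongr
    _ = 2 * x * (1 + t ^ 2)⁻¹ * (1 + t ^ 2) := by field_simp

/-- **Horizontal decay**: `sup_{−η ≤ Re u ≤ 1} ‖G(u + iT)‖ → 0` (`|T| → ∞`), from the crude
`‖L(s,χ)‖ ≤ q|s|Z_{1/2}`. [folklore] -/
theorem G_horizontal_decay (hχ : χ ≠ 1) {δ : ℂ} (hδre : δ.re = 0) (hδ1 : ‖δ‖ ≤ 1) {x : ℝ}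
    (hx1 : 1 ≤ x) {η : ℝ} (hη : η ≤ 1 / 2) (ε : ℝ) (hε : 0 < ε) :
    ∃ T₀ : ℝ, ∀ T : ℝ, T₀ ≤ |T| → ∀ u ∈ Icc (-η) 1, ‖G χ δ x (u + T * I)‖ ≤ ε := by
  have hx0 : 0 < x := by linarith
  have hq0 : (0 : ℝ) ≤ q := Nat.cast_nonneg q
  have hZ := Zhalf_nonneg
  set B : ℝ := 2 * x * q * Zhalf with hB
  have hB0 : 0 ≤ B := by rw [hB]; positivity
  refine ⟨max 2 (B / ε), fun T hT u hu => ?_⟩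
  have hT2 : 2 ≤ |T| := le_trans (le_max_left _ _) hT
  have hTB : B / ε ≤ |T| := le_trans (le_max_right _ _) hT
  have hT0 : 0 < |T| := by linarith
  set w : ℂ := (u : ℂ) + T * I with hw
  have hwT : |T| ≤ ‖w‖ := by
    have := Complex.abs_im_le_norm w
    simpa [hw] using this
  have hw2 : 2 ≤ ‖w‖ := hT2.trans hwT
  have hwpos : 0 < ‖w‖ := by linarith
  have hwre : w.re = u := by simp [hw]
  -- the three factors
  have hxw : ‖(x : ℂ) ^ w‖ ≤ x := by
    rw [Complex.norm_cpow_eq_rpow_re_of_pos hx0, hwre]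
    calc x ^ u ≤ x ^ (1 : ℝ) := Real.rpow_le_rpow_of_exponent_le hx1 hu.2
      _ = x := Real.rpow_one x
  have hFw : ‖Fδ χ δ w‖ ≤ q * (2 * ‖w‖) * Zhalf := by
    have hre : 1 / 2 ≤ (1 + δ + w).re := by
      simp only [add_re, one_re, hδre, hwre]; linarith [hu.1]
    refine (norm_LFunction_le_crude χ hχ hre).trans ?_
    have hn : ‖1 + δ + w‖ ≤ 2 * ‖w‖ := by
      calc ‖1 + δ + w‖ ≤ ‖(1 : ℂ) + δ‖ + ‖w‖ := norm_add_le _ _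
        _ ≤ ‖(1 : ℂ)‖ + ‖δ‖ + ‖w‖ := by linarith [norm_add_le (1 : ℂ) δ]
        _ ≤ 2 * ‖w‖ := by rw [norm_one]; linarith
    gcongr
  -- assemble
  rw [G, norm_div, norm_mul, norm_pow]
  rw [div_le_iff₀ (by positivity)]
  calc ‖(x : ℂ) ^ w‖ * ‖Fδ χ δ w‖ ≤ x * (q * (2 * ‖w‖) * Zhalf) :=
        mul_le_mul hxw hFw (norm_nonneg _) (by linarith)
    _ = B * ‖w‖ := by rw [hB]; ring
    _ ≤ (ε * ‖w‖) * ‖w‖ := by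
        apply mul_le_mul_of_nonneg_right _ hwpos.le
        have : B ≤ ε * |T| := by rwa [div_le_iff₀ hε, mul_comm] at hTB
        calc B ≤ ε * |T| := this
          _ ≤ ε * ‖w‖ := mul_le_mul_of_nonneg_left hwT hε.le
    _ = ε * ‖w‖ ^ 2 := by ring

/-! #### The left line `Re u = −1/𝓛` -/

omit [NeZero q] in
/-- `log y ≤ 3 y^{1/3}` for `y > 0`. [folklore] -/
theorem log_le_three_mul_rpow_third {y : ℝ} (hy : 0 < y) : Real.log y ≤ 3 * y ^ (1 / 3 : ℝ) := by
  have h1 : Real.log (y ^ (1 / 3 : ℝ)) = (1 / 3) * Real.log y := Real.log_rpow hy _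
  have h2 : Real.log (y ^ (1 / 3 : ℝ)) ≤ y ^ (1 / 3 : ℝ) - 1 :=
    Real.log_le_sub_one_of_pos (Real.rpow_pos_of_pos hy _)
  linarith

/-- **`F` on the left line**: for `log q ≥ 3`, `χ ≠ 1`, `δ` purely imaginary with `‖δ‖ ≤ 1`,
`η = 1/log q`: `‖F(−η+it)‖ = ‖L(1−η+δ+it,χ)‖ ≤ 4e·log q·(|t|+3)^{2/3}`. [folklore] -/
theorem norm_Fδ_left_le (hq : 3 ≤ Real.log q) (hχ : χ ≠ 1) {δ : ℂ} (hδre : δ.re = 0)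
    (hδ1 : ‖δ‖ ≤ 1) (t : ℝ) :
    ‖Fδ χ δ ((((-(1 / Real.log q)) : ℝ) : ℂ) + t * I)‖ ≤
      4 * Real.exp 1 * Real.log q * (|t| + 3) ^ (2 / 3 : ℝ) := by
  set Lq : ℝ := Real.log q with hLdef
  have hL0 : 0 < Lq := by linarith
  have hq0 : (0 : ℝ) < q := by exact_mod_cast NeZero.pos q
  set η : ℝ := 1 / Lq with hηdef
  have hη0 : 0 < η := by positivity
  have hη3 : η ≤ 1 / 3 := by
    rw [hηdef, div_le_div_iff₀ hL0 (by norm_num)]; linarith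
  set s : ℂ := 1 + δ + ((((-η) : ℝ) : ℂ) + t * I) with hsdef
  have hsre : s.re = 1 - η := by simp [hsdef, hδre]; ring
  have hσ0 : 1 / 2 ≤ s.re := by rw [hsre]; linarith
  have hσ1 : s.re ≤ 1 := by rw [hsre]; linarith
  have hexp : 1 - s.re = η := by rw [hsre]; ring
  -- `‖s‖ + 1 ≤ |t| + 3`
  have hsn : ‖s‖ + 1 ≤ |t| + 3 := by
    have hs' : s = (((1 - η : ℝ)) : ℂ) + δ + (t : ℂ) * I := by
      rw [hsdef]; push_cast; ring
    have h1 : ‖s‖ ≤ ‖(((1 - η : ℝ)) : ℂ) + δ‖ + ‖(t : ℂ) * I‖ := by rw [hs']; exact norm_add_le _ _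
    have h2 : ‖(((1 - η : ℝ)) : ℂ) + δ‖ ≤ 2 := by
      calc ‖(((1 - η : ℝ)) : ℂ) + δ‖ ≤ ‖(((1 - η : ℝ)) : ℂ)‖ + ‖δ‖ := norm_add_le _ _
        _ ≤ 1 + 1 := by
            rw [Complex.norm_real, Real.norm_eq_abs, abs_of_nonneg (by linarith)]
            exact add_le_add (by linarith) hδ1
        _ = 2 := by norm_num
    have h3 : ‖(t : ℂ) * I‖ = |t| := by
      rw [norm_mul, Complex.norm_I, mul_one, Complex.norm_real, Real.norm_eq_abs]
    linarith
  set y : ℝ := |t| + 3 with hydef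
  have hy3 : 3 ≤ y := by rw [hydef]; linarith [abs_nonneg t]
  have hy0 : 0 < y := by linarith
  have hy1 : 1 ≤ y := by linarith
  have hs1 : 0 < ‖s‖ + 1 := by positivity
  -- (B1)
  have hB := norm_LFunction_le_left χ hχ hσ0 hσ1
  rw [hexp] at hB
  -- the power factor: `(q(‖s‖+1))^η ≤ e · y^{1/3}`
  have hqη : (q : ℝ) ^ η = Real.exp 1 := by
    rw [Real.rpow_def_of_pos hq0, hηdef]
    congr 1
    rw [← hLdef, one_div, mul_inv_cancel₀ hL0.ne']
  have hpow : ((q : ℝ) * (‖s‖ + 1)) ^ η ≤ Real.exp 1 * y ^ (1 / 3 : ℝ) := by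
    calc ((q : ℝ) * (‖s‖ + 1)) ^ η ≤ ((q : ℝ) * y) ^ η :=
          Real.rpow_le_rpow (by positivity) (by nlinarith) hη0.le
      _ = (q : ℝ) ^ η * y ^ η := Real.mul_rpow hq0.le hy0.le
      _ ≤ Real.exp 1 * y ^ (1 / 3 : ℝ) := by
          rw [hqη]
          exact mul_le_mul_of_nonneg_left (Real.rpow_le_rpow_of_exponent_le hy1 hη3)
            (Real.exp_pos 1).le
  -- the logarithmic factor: `4 + log q + log(‖s‖+1) ≤ 4 log q · y^{1/3}`
  have hy13 : 1 ≤ y ^ (1 / 3 : ℝ) := Real.one_le_rpow hy1 (by norm_num)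
  have hlogy : Real.log (‖s‖ + 1) ≤ 3 * y ^ (1 / 3 : ℝ) :=
    (Real.log_le_log hs1 hsn).trans (log_le_three_mul_rpow_third hy0)
  have hlogfac : 4 + Lq + Real.log (‖s‖ + 1) ≤ 4 * Lq * y ^ (1 / 3 : ℝ) := by
    have h1 : 4 + Lq ≤ 3 * Lq := by linarith
    have h2 : 3 * Lq ≤ 3 * Lq * y ^ (1 / 3 : ℝ) := by
      have := mul_le_mul_of_nonneg_left hy13 (show 0 ≤ 3 * Lq by positivity)
      linarith
    have h3 : 3 * y ^ (1 / 3 : ℝ) ≤ Lq * y ^ (1 / 3 : ℝ) :=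
      mul_le_mul_of_nonneg_right hq (by positivity)
    linarith
  -- combine
  have hy23 : y ^ (1 / 3 : ℝ) * y ^ (1 / 3 : ℝ) = y ^ (2 / 3 : ℝ) := by
    rw [← Real.rpow_add hy0]; norm_num
  have hfac0 : 0 ≤ 4 + Lq + Real.log (‖s‖ + 1) := by
    have := Real.log_nonneg (by linarith [norm_nonneg s] : (1 : ℝ) ≤ ‖s‖ + 1)
    linarith
  have : Fδ χ δ ((((-(1 / Real.log q)) : ℝ) : ℂ) + t * I) = χ.LFunction s := by
    simp only [Fδ, hsdef, hηdef, hLdef]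
  rw [this]
  calc ‖χ.LFunction s‖ ≤ ((q : ℝ) * (‖s‖ + 1)) ^ η * (4 + Lq + Real.log (‖s‖ + 1)) := hB
    _ ≤ (Real.exp 1 * y ^ (1 / 3 : ℝ)) * (4 * Lq * y ^ (1 / 3 : ℝ)) :=
        mul_le_mul hpow hlogfac hfac0 (by positivity)
    _ = 4 * Real.exp 1 * Lq * (y ^ (1 / 3 : ℝ) * y ^ (1 / 3 : ℝ)) := by ring
    _ = 4 * Real.exp 1 * Lq * y ^ (2 / 3 : ℝ) := by rw [hy23]

omit [NeZero q] in
/-- The fixed majorant `h(t) = (|t|+3)^{2/3} (1/9 + t²)^{-1}` of the left line. [folklore] -/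
def leftMajorant (t : ℝ) : ℝ := (|t| + 3) ^ (2 / 3 : ℝ) * (1 / 9 + t ^ 2)⁻¹

omit [NeZero q] in
/-- `h ≥ 0`. [folklore] -/
theorem leftMajorant_nonneg (t : ℝ) : 0 ≤ leftMajorant t := by unfold leftMajorant; positivity

omit [NeZero q] in
/-- `h` is continuous. [folklore] -/
theorem continuous_leftMajorant : Continuous leftMajorant := by
  unfold leftMajorant
  refine Continuous.mul ?_ ?_
  · exact (continuous_abs.add continuous_const).rpow_const fun t => Or.inr (by norm_num)
  · exact Continuous.inv₀ (by fun_prop) fun t => by positivity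

omit [NeZero q] in
/-- `h(t) ≤ 54 (1+|t|)^{-4/3}`. [folklore] -/
theorem leftMajorant_le (t : ℝ) : leftMajorant t ≤ 54 * (1 + ‖t‖) ^ (-(4 / 3 : ℝ)) := by
  rw [Real.norm_eq_abs]
  have ht := abs_nonneg t
  set z : ℝ := 1 + |t| with hz
  have hz1 : 1 ≤ z := by rw [hz]; linarith
  have hz0 : 0 < z := by linarith
  -- `(|t|+3)^{2/3} ≤ 3 z^{2/3}`
  have h1 : (|t| + 3) ^ (2 / 3 : ℝ) ≤ 3 * z ^ (2 / 3 : ℝ) := by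
    calc (|t| + 3) ^ (2 / 3 : ℝ) ≤ (3 * z) ^ (2 / 3 : ℝ) :=
          Real.rpow_le_rpow (by positivity) (by rw [hz]; linarith) (by norm_num)
      _ = (3 : ℝ) ^ (2 / 3 : ℝ) * z ^ (2 / 3 : ℝ) := Real.mul_rpow (by norm_num) hz0.le
      _ ≤ 3 * z ^ (2 / 3 : ℝ) := by
          apply mul_le_mul_of_nonneg_right _ (by positivity)
          calc (3 : ℝ) ^ (2 / 3 : ℝ) ≤ (3 : ℝ) ^ (1 : ℝ) :=
                Real.rpow_le_rpow_of_exponent_le (by norm_num) (by norm_num)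
            _ = 3 := Real.rpow_one 3
  -- `(1/9 + t²)⁻¹ ≤ 18 / z²`
  have h2 : (1 / 9 + t ^ 2)⁻¹ ≤ 18 / z ^ 2 := by
    rw [inv_eq_one_div, div_le_div_iff₀ (by positivity) (by positivity)]
    have : z ^ 2 ≤ 2 + 2 * t ^ 2 := by
      rw [hz]
      have : |t| ^ 2 = t ^ 2 := sq_abs t
      nlinarith [sq_nonneg (|t| - 1)]
    nlinarith
  -- `z^{2/3} / z² = z^{-4/3}`
  have h3 : z ^ (2 / 3 : ℝ) / z ^ 2 = z ^ (-(4 / 3 : ℝ)) := by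
    rw [show (-(4 / 3 : ℝ)) = 2 / 3 - 2 by norm_num, Real.rpow_sub hz0, Real.rpow_two]
  unfold leftMajorant
  calc (|t| + 3) ^ (2 / 3 : ℝ) * (1 / 9 + t ^ 2)⁻¹ ≤ (3 * z ^ (2 / 3 : ℝ)) * (18 / z ^ 2) :=
        mul_le_mul h1 h2 (by positivity) (by positivity)
    _ = 54 * (z ^ (2 / 3 : ℝ) / z ^ 2) := by ring
    _ = 54 * z ^ (-(4 / 3 : ℝ)) := by rw [h3]

omit [NeZero q] in
/-- `h` is integrable on `ℝ` (comparison with `(1+|t|)^{-4/3}`, Mathlib's `integrable_one_add_norm`).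
[folklore] -/
theorem integrable_leftMajorant : Integrable leftMajorant := by
  have hg : Integrable fun t : ℝ => (1 + ‖t‖) ^ (-(4 / 3 : ℝ)) :=
    integrable_one_add_norm (by rw [Module.finrank_self]; norm_num)
  refine (hg.const_mul 54).mono' continuous_leftMajorant.aestronglyMeasurable
    (Eventually.of_forall fun t => ?_)
  rw [Real.norm_eq_abs, abs_of_nonneg (leftMajorant_nonneg t)]
  exact leftMajorant_le t

omit [NeZero q] in
/-- `I₀ = ∫ h`, an absolute constant. [folklore] -/
def I0 : ℝ := ∫ t : ℝ, leftMajorant t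

omit [NeZero q] in
/-- `I₀ ≥ 0`. [folklore] -/
theorem I0_nonneg : 0 ≤ I0 := integral_nonneg fun t => leftMajorant_nonneg t

/-- **`G` on the left line**: `‖G(−η+it)‖ ≤ x^{−η} · (4e/9)(log q)³ · h(t)`. [folklore] -/
theorem norm_G_left_le (hq : 3 ≤ Real.log q) (hχ : χ ≠ 1) {δ : ℂ} (hδre : δ.re = 0)
    (hδ1 : ‖δ‖ ≤ 1) {x : ℝ} (hx : 0 < x) (t : ℝ) :
    ‖G χ δ x ((((-(1 / Real.log q)) : ℝ) : ℂ) + t * I)‖ ≤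
      x ^ (-(1 / Real.log q)) * (4 / 9 * Real.exp 1 * Real.log q ^ 3) * leftMajorant t := by
  set Lq : ℝ := Real.log q with hLdef
  have hL0 : 0 < Lq := by linarith
  set η : ℝ := 1 / Lq with hηdef
  have hη0 : 0 < η := by positivity
  have hF := norm_Fδ_left_le χ hq hχ hδre hδ1 t
  have hnsq : ‖(((-η : ℝ)) : ℂ) + t * I‖ ^ 2 = η ^ 2 + t ^ 2 := by
    rw [Complex.sq_norm, Complex.normSq_apply]; simp; ring
  have hre : ((((-η : ℝ)) : ℂ) + t * I).re = -η := by simp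
  rw [G, norm_div, norm_mul, norm_pow, hnsq, Complex.norm_cpow_eq_rpow_re_of_pos hx, hre]
  -- `1/(η² + t²) ≤ (L²/9) (1/9 + t²)⁻¹`
  have hden : 1 / (η ^ 2 + t ^ 2) ≤ Lq ^ 2 / 9 * (1 / 9 + t ^ 2)⁻¹ := by
    rw [inv_eq_one_div, ← mul_div_assoc, mul_one, div_div,
      div_le_div_iff₀ (by positivity) (by positivity), one_mul]
    have hLη : Lq * η = 1 := by rw [hηdef]; field_simp
    have hL9 : 9 ≤ Lq ^ 2 := by nlinarith
    have : Lq ^ 2 * (η ^ 2 + t ^ 2) = 1 + Lq ^ 2 * t ^ 2 := by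
      calc Lq ^ 2 * (η ^ 2 + t ^ 2) = (Lq * η) ^ 2 + Lq ^ 2 * t ^ 2 := by ring
        _ = 1 + Lq ^ 2 * t ^ 2 := by rw [hLη]; ring
    rw [this]
    nlinarith [sq_nonneg t]
  have hxη : 0 ≤ x ^ (-η) := by positivity
  calc x ^ (-η) * ‖Fδ χ δ ((((-η : ℝ)) : ℂ) + t * I)‖ / (η ^ 2 + t ^ 2)
      = x ^ (-η) * ‖Fδ χ δ ((((-η : ℝ)) : ℂ) + t * I)‖ * (1 / (η ^ 2 + t ^ 2)) := by ring
    _ ≤ x ^ (-η) * (4 * Real.exp 1 * Lq * (|t| + 3) ^ (2 / 3 : ℝ)) *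
          (Lq ^ 2 / 9 * (1 / 9 + t ^ 2)⁻¹) :=
        mul_le_mul (mul_le_mul_of_nonneg_left hF hxη) hden (by positivity) (by positivity)
    _ = x ^ (-η) * (4 / 9 * Real.exp 1 * Lq ^ 3) * leftMajorant t := by
        simp only [leftMajorant]; ring

/-- Integrability of `G` on the left line. [folklore] -/
theorem integrable_G_left (hq : 3 ≤ Real.log q) (hχ : χ ≠ 1) {δ : ℂ} (hδre : δ.re = 0)
    (hδ1 : ‖δ‖ ≤ 1) {x : ℝ} (hx : 0 < x) :
    Integrable fun t : ℝ => G χ δ x ((((-(1 / Real.log q)) : ℝ) : ℂ) + t * I) := by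
  have hL0 : 0 < Real.log q := by linarith
  have hc : -(1 / Real.log q) ≠ 0 := by
    have : 0 < 1 / Real.log q := by positivity
    linarith
  have hcont := continuous_G_line χ hχ δ hx hc
  refine ((integrable_leftMajorant.const_mul (x ^ (-(1 / Real.log q)) *
    (4 / 9 * Real.exp 1 * Real.log q ^ 3))).mono' hcont.aestronglyMeasurable
    (Eventually.of_forall fun t => ?_))
  exact norm_G_left_le χ hq hχ hδre hδ1 hx t

/-- **The left line integral**: `‖∫ G(−η+it) dt‖ ≤ x^{−η} (4e/9)(log q)³ I₀`. [folklore] -/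
theorem norm_integral_G_left_le (hq : 3 ≤ Real.log q) (hχ : χ ≠ 1) {δ : ℂ} (hδre : δ.re = 0)
    (hδ1 : ‖δ‖ ≤ 1) {x : ℝ} (hx : 0 < x) :
    ‖∫ t : ℝ, G χ δ x ((((-(1 / Real.log q)) : ℝ) : ℂ) + t * I)‖ ≤
      x ^ (-(1 / Real.log q)) * (4 / 9 * Real.exp 1 * Real.log q ^ 3) * I0 := by
  have h := norm_integral_le_of_norm_le
    (integrable_leftMajorant.const_mul (x ^ (-(1 / Real.log q)) * (4 / 9 * Real.exp 1 * Real.log q ^ 3)))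
    (Eventually.of_forall fun t => norm_G_left_le χ hq hχ hδre hδ1 hx t)
  rwa [integral_const_mul] at h

end Strip


/-! ### §4. The residue at the double pole `u = 0` and its evaluation by Lemma 5.8 -/

section Residue

open Literature.NumberTheory.LFunctions.Zhang2022.Lemma58 (lemma_5_8_of_le
  norm_taylor_two_remainder_le)

/-- **The residue**: `((swap dslope 0)^[1] φ)(0) = φ′(0) = (log x) L(1+δ,χ) + L′(1+δ,χ)`.
[cite: Zhang2022LandauSiegel, §8, proof of Lemma 8.2 (the double pole `(s − β_μ)^{-2}`)] -/
theorem residue_eq (hχ : χ ≠ 1) (δ : ℂ) {x : ℝ} (hx : 0 < x) :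
    (Function.swap dslope (0 : ℂ))^[1] (phi χ δ x) 0 =
      (Real.log x : ℂ) * χ.LFunction (1 + δ) + deriv χ.LFunction (1 + δ) := by
  show dslope (phi χ δ x) 0 0 = _
  rw [dslope_same]
  have hx0 : (x : ℂ) ≠ 0 := by exact_mod_cast hx.ne'
  have hc : HasDerivAt (fun u : ℂ => (x : ℂ) ^ u) ((x : ℂ) ^ (0 : ℂ) * Complex.log x) 0 :=
    (Complex.hasStrictDerivAt_const_cpow (Or.inl hx0)).hasDerivAt
  have hF : HasDerivAt (fun u : ℂ => χ.LFunction (1 + δ + u)) (deriv χ.LFunction (1 + δ)) 0 := by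
    have h := ((DirichletCharacter.differentiable_LFunction hχ) ((1 + δ) + 0)).hasDerivAt
    have h2 := h.comp_const_add (1 + δ) 0
    simpa only [add_zero] using h2
  have hprod := hc.fun_mul hF
  have leftMajorant : phi χ δ x = fun u => (x : ℂ) ^ u * χ.LFunction (1 + δ + u) := rfl
  rw [leftMajorant, hprod.deriv, Complex.cpow_zero, ← Complex.ofReal_log hx.le]
  simp

/-- **The residue against the main term**: for `χ` primitive mod `D`, `log D ≥ 3`, (A),
`4Kπ ≤ 𝓛⁸`, `‖δ‖ ≤ Kα` (`α = π𝓛^{-9}`) and `1 ≤ x ≤ P = e^{𝓛⁹}`: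
`‖(log x)L(1+δ,χ) + L′(1+δ,χ) − L′(1,χ)(1 + δ log x)‖ ≤ (C_K + 64e^{9/2}(K+1)π) 𝓛^{-6}`,
`C_K = 1 + 16e^{9/2}π²K²` — Lemma 5.8 for `L(1+δ,χ) = L′(1,χ)δ + O(𝓛^{-15})` (times
`log x ≤ 𝓛⁹`) and a Cauchy estimate for `L′(1+δ,χ) − L′(1,χ) = O(α𝓛³)`; this is the source's
"`= L′(1,χ)·(2πi)^{-1}∮ x^s(s−β_j)(s−β_μ)^{-2}ds + O(𝓛^{-6})`" followed by "direct calculation".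
[cite: Zhang2022LandauSiegel, §8, proof of Lemma 8.2; §5, Lemma 5.8] -/
theorem norm_residue_sub_main_le {D : ℕ} [NeZero D] (χ : DirichletCharacter ℂ D)
    (hprim : χ.IsPrimitive) (hL : 3 ≤ Real.log D) (hA : ‖χ.LFunction 1‖ ≤ 1 / Real.log D ^ 2022)
    {K : ℝ} (hK0 : 0 ≤ K) (hK : 4 * K * π ≤ Real.log D ^ 8) {δ : ℂ}
    (hδ : ‖δ‖ ≤ K * π / Real.log D ^ 9) {x : ℝ} (hx1 : 1 ≤ x)
    (hxP : x ≤ Real.exp (Real.log D ^ 9)) :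
    ‖(Real.log x : ℂ) * χ.LFunction (1 + δ) + deriv χ.LFunction (1 + δ) -
        deriv χ.LFunction 1 * (1 + δ * Real.log x)‖ ≤
      ((1 + 16 * Real.exp (9 / 2) * π ^ 2 * K ^ 2) + 64 * Real.exp (9 / 2) * (K + 1) * π) /
        Real.log D ^ 6 := by
  have hD2 : 2 ≤ D := by
    rcases Nat.lt_or_ge D 2 with h | h
    · interval_cases D <;> norm_num at hL
    · exact h
  set Lg : ℝ := Real.log D with hLdef
  have hL0 : 0 < Lg := by linarith
  have hL1 : 1 ≤ Lg := by linarith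
  have hπ := Real.pi_pos
  have hχ1 : χ ≠ 1 := Lemma31.ne_one_of_isPrimitive χ hD2 hprim
  have hx0 : 0 < x := by linarith
  have hlogx0 : 0 ≤ Real.log x := Real.log_nonneg hx1
  have hlogxP : Real.log x ≤ Lg ^ 9 := by
    have := Real.log_le_log hx0 hxP
    rwa [Real.log_exp] at this
  -- (i) Lemma 5.8 at `s = 1 + δ`
  have hKL : K * π ≤ Lg ^ 8 := by nlinarith
  have hE1 := lemma_5_8_of_le χ hprim hL hA (K := K) hKL (s := 1 + δ) (by simpa using hδ)
  rw [show (1 : ℂ) + δ - 1 = δ by ring] at hE1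
  -- (ii) Cauchy estimate for `L′(1+δ) − L′(1)`
  set r : ℝ := (K + 1) * π / Lg ^ 9 with hrdef
  have hr0 : 0 < r := by positivity
  have hδr : ‖δ‖ ≤ r := by
    refine hδ.trans ?_
    rw [hrdef]; gcongr; linarith
  have h2r : 2 * r ≤ 1 / Lg := by
    have h8 : (3 : ℝ) ^ 8 ≤ Lg ^ 8 := pow_le_pow_left₀ (by norm_num) hL 8
    have h2K : 2 * (K + 1) * π ≤ Lg ^ 8 := by nlinarith [Real.pi_le_four]
    rw [hrdef, show 2 * ((K + 1) * π / Lg ^ 9) = (2 * (K + 1) * π) / Lg ^ 9 by ring,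
      div_le_div_iff₀ (pow_pos hL0 9) hL0]
    calc 2 * (K + 1) * π * Lg ≤ Lg ^ 8 * Lg := mul_le_mul_of_nonneg_right h2K hL0.le
      _ = 1 * Lg ^ 9 := by ring
  set Gf : ℂ → ℂ := fun z => χ.LFunction z - χ.LFunction 1 - deriv χ.LFunction 1 * (z - 1)
    with hGfdef
  have hLd := DirichletCharacter.differentiable_LFunction hχ1
  have hGf_diff : Differentiable ℂ Gf := by
    rw [hGfdef]; fun_prop
  have hGf_deriv : deriv Gf (1 + δ) = deriv χ.LFunction (1 + δ) - deriv χ.LFunction 1 := by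
    have h1 : HasDerivAt χ.LFunction (deriv χ.LFunction (1 + δ)) (1 + δ) := (hLd _).hasDerivAt
    have h2 : HasDerivAt (fun z : ℂ => deriv χ.LFunction 1 * (z - 1)) (deriv χ.LFunction 1 * 1)
        (1 + δ) := ((hasDerivAt_id _).sub_const 1).const_mul _
    have h := (h1.sub_const (χ.LFunction 1)).sub h2
    rw [mul_one] at h
    exact h.deriv
  set M : ℝ := 8 * Real.exp (9 / 2) * (1 + Lg) * Lg ^ 2 * (2 * r) ^ 2 with hMdef
  have hsphere : ∀ z ∈ Metric.sphere (1 + δ) r, ‖Gf z‖ ≤ M := by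
    intro z hz
    rw [Metric.mem_sphere, dist_eq_norm] at hz
    have hz1 : ‖z - 1‖ ≤ 2 * r := by
      calc ‖z - 1‖ = ‖(z - (1 + δ)) + δ‖ := by ring_nf
        _ ≤ ‖z - (1 + δ)‖ + ‖δ‖ := norm_add_le _ _
        _ ≤ 2 * r := by rw [hz]; linarith
    have hz1' : ‖z - 1‖ ≤ 1 / Real.log D := hz1.trans h2r
    have h := norm_taylor_two_remainder_le χ hL hprim hz1'
    refine h.trans ?_
    rw [hMdef]
    have : ‖z - 1‖ ^ 2 ≤ (2 * r) ^ 2 := pow_le_pow_left₀ (norm_nonneg _) hz1 2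
    have h0 : 0 ≤ 8 * Real.exp (9 / 2) * (1 + Lg) * Lg ^ 2 := by positivity
    exact mul_le_mul_of_nonneg_left this h0
  have hE2 : ‖deriv χ.LFunction (1 + δ) - deriv χ.LFunction 1‖ ≤
      64 * Real.exp (9 / 2) * (K + 1) * π / Lg ^ 6 := by
    rw [← hGf_deriv]
    have h := Complex.norm_deriv_le_of_forall_mem_sphere_norm_le hr0 hGf_diff.diffContOnCl hsphere
    refine h.trans ?_
    have hMr : M / r = 32 * Real.exp (9 / 2) * (1 + Lg) * Lg ^ 2 * r := by
      rw [hMdef]; field_simp; ring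
    rw [hMr, hrdef]
    have h1L : 1 + Lg ≤ 2 * Lg := by linarith
    rw [show 32 * Real.exp (9 / 2) * (1 + Lg) * Lg ^ 2 * ((K + 1) * π / Lg ^ 9) =
      (32 * Real.exp (9 / 2) * (K + 1) * π) * ((1 + Lg) * Lg ^ 2 / Lg ^ 9) by ring,
      show 64 * Real.exp (9 / 2) * (K + 1) * π / Lg ^ 6 =
      (32 * Real.exp (9 / 2) * (K + 1) * π) * (2 / Lg ^ 6) by ring]
    refine mul_le_mul_of_nonneg_left ?_ (by positivity)
    rw [div_le_div_iff₀ (by positivity) (by positivity)]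
    calc (1 + Lg) * Lg ^ 2 * Lg ^ 6 ≤ (2 * Lg) * Lg ^ 2 * Lg ^ 6 := by gcongr
      _ = 2 * Lg ^ 9 := by ring
  -- (iii) assemble
  have hsplit : (Real.log x : ℂ) * χ.LFunction (1 + δ) + deriv χ.LFunction (1 + δ) -
      deriv χ.LFunction 1 * (1 + δ * Real.log x) =
      (Real.log x : ℂ) * (χ.LFunction (1 + δ) - deriv χ.LFunction 1 * δ) +
        (deriv χ.LFunction (1 + δ) - deriv χ.LFunction 1) := by ring
  rw [hsplit]
  have hnlog : ‖(Real.log x : ℂ)‖ = Real.log x := by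
    rw [Complex.norm_real, Real.norm_eq_abs, abs_of_nonneg hlogx0]
  calc ‖(Real.log x : ℂ) * (χ.LFunction (1 + δ) - deriv χ.LFunction 1 * δ) +
        (deriv χ.LFunction (1 + δ) - deriv χ.LFunction 1)‖
      ≤ ‖(Real.log x : ℂ) * (χ.LFunction (1 + δ) - deriv χ.LFunction 1 * δ)‖ +
        ‖deriv χ.LFunction (1 + δ) - deriv χ.LFunction 1‖ := norm_add_le _ _
    _ ≤ Lg ^ 9 * ((1 + 16 * Real.exp (9 / 2) * π ^ 2 * K ^ 2) / Lg ^ 15) +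
        64 * Real.exp (9 / 2) * (K + 1) * π / Lg ^ 6 := by
        rw [norm_mul, hnlog]
        exact add_le_add (mul_le_mul hlogxP hE1 (norm_nonneg _) (by positivity)) hE2
    _ = ((1 + 16 * Real.exp (9 / 2) * π ^ 2 * K ^ 2) + 64 * Real.exp (9 / 2) * (K + 1) * π) /
        Lg ^ 6 := by
        field_simp

end Residue

/-! ### §5. Assembly: the core estimate, Lemma 8.2 in general and in printed form -/

section Assembly

/-- `x^{-1/𝓛} (log q)³ ≤ 90!·𝓛^{-6}` for `x ≥ T = exp(𝓛^{11/10})`: with `y = 𝓛^{1/10}`,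
`x^{-1/𝓛} ≤ e^{-y}` and `𝓛⁹ e^{-y} = y^{90}e^{-y} ≤ 90!`. [folklore] -/
theorem rpow_neg_inv_log_mul_le {Lg x : ℝ} (hL : 3 ≤ Lg) (hx : Real.exp (Lg ^ (11 / 10 : ℝ)) ≤ x) :
    x ^ (-(1 / Lg)) * Lg ^ 3 ≤ (Nat.factorial 90 : ℝ) / Lg ^ 6 := by
  have hL0 : 0 < Lg := by linarith
  have hx0 : 0 < x := lt_of_lt_of_le (Real.exp_pos _) hx
  set y : ℝ := Lg ^ (1 / 10 : ℝ) with hydef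
  have hy0 : 0 < y := Real.rpow_pos_of_pos hL0 _
  have hyL : y ^ 10 = Lg := by
    rw [hydef, ← Real.rpow_natCast, ← Real.rpow_mul hL0.le]; norm_num
  have hL11 : Lg ^ (11 / 10 : ℝ) = Lg * y := by
    rw [hydef, show (11 / 10 : ℝ) = 1 + 1 / 10 by norm_num, Real.rpow_add hL0, Real.rpow_one]
  -- `x^{-1/L} ≤ e^{-y}`
  have hlogx : Lg * y ≤ Real.log x := by
    rw [← hL11]; exact (Real.le_log_iff_exp_le hx0).2 hx
  have hxη : x ^ (-(1 / Lg)) ≤ Real.exp (-y) := by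
    rw [Real.rpow_def_of_pos hx0, Real.exp_le_exp]
    have : y ≤ Real.log x * (1 / Lg) := by
      rw [← div_eq_mul_one_div, le_div_iff₀ hL0]; linarith
    linarith
  -- `L⁹ e^{-y} ≤ 90!`
  have hfac : y ^ 90 * Real.exp (-y) ≤ (Nat.factorial 90 : ℝ) := by
    have h := Real.pow_div_factorial_le_exp (x := y) hy0.le 90
    have hf0 : (0 : ℝ) < (Nat.factorial 90 : ℝ) := by positivity
    rw [div_le_iff₀ hf0] at h
    rw [Real.exp_neg]
    have hexp := Real.exp_pos y
    calc y ^ 90 * (Real.exp y)⁻¹ ≤ (Real.exp y * (Nat.factorial 90 : ℝ)) * (Real.exp y)⁻¹ := by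
          gcongr
      _ = (Nat.factorial 90 : ℝ) := by field_simp
  have hL9 : Lg ^ 9 = y ^ 90 := by rw [← hyL]; ring
  rw [le_div_iff₀ (by positivity)]
  calc x ^ (-(1 / Lg)) * Lg ^ 3 * Lg ^ 6 = x ^ (-(1 / Lg)) * Lg ^ 9 := by ring
    _ ≤ Real.exp (-y) * y ^ 90 := by
        rw [hL9]; exact mul_le_mul_of_nonneg_right hxη (by positivity)
    _ ≤ (Nat.factorial 90 : ℝ) := by rw [mul_comm]; exact hfac

/-- The constant of Lemma 8.2 (depends only on `K`, the size of the shifts in units of `α`).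
[folklore] -/
def C82 (K : ℝ) : ℝ :=
  1 / (2 * π) * (4 / 9 * Real.exp 1 * I0 * (Nat.factorial 90 : ℝ)) +
    ((1 + 16 * Real.exp (9 / 2) * π ^ 2 * K ^ 2) + 64 * Real.exp (9 / 2) * (K + 1) * π)

/-- **The core estimate** (Lemma 8.2 with the factor `x^{β_μ}` removed): for `χ` primitive mod `D`,
`log D ≥ 3`, (A) `‖L(1,χ)‖ ≤ 𝓛^{-2022}`, `4Kπ ≤ 𝓛⁸`, `δ` purely imaginary with `‖δ‖ ≤ Kα`,
`α = π𝓛^{-9}`, and `T = exp(𝓛^{11/10}) ≤ x ≤ P = exp(𝓛⁹)`: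
`‖∑_{m ≤ x} χ(m) m^{-1-δ} log(x/m) − L′(1,χ)(1 + δ log x)‖ ≤ C82(K) 𝓛^{-6}`.
[cite: Zhang2022LandauSiegel, §8, Lemma 8.2] -/
theorem sum_twist_log_sub_main_le {D : ℕ} [NeZero D] (χ : DirichletCharacter ℂ D)
    (hprim : χ.IsPrimitive) (hL : 3 ≤ Real.log D) (hA : ‖χ.LFunction 1‖ ≤ 1 / Real.log D ^ 2022)
    {K : ℝ} (hK0 : 0 ≤ K) (hK : 4 * K * π ≤ Real.log D ^ 8) {δ : ℂ} (hδre : δ.re = 0)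
    (hδ : ‖δ‖ ≤ K * π / Real.log D ^ 9) {x : ℝ} (hxT : Real.exp (Real.log D ^ (11 / 10 : ℝ)) ≤ x)
    (hxP : x ≤ Real.exp (Real.log D ^ 9)) :
    ‖(∑ m ∈ Finset.Ioc 0 ⌊x⌋₊, twist χ δ m * (Real.log (x / m) : ℂ)) -
        deriv χ.LFunction 1 * (1 + δ * Real.log x)‖ ≤ C82 K / Real.log D ^ 6 := by
  have hD2 : 2 ≤ D := by
    rcases Nat.lt_or_ge D 2 with h | h
    · interval_cases D <;> norm_num at hL
    · exact h
  set Lg : ℝ := Real.log D with hLdef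
  have hL0 : 0 < Lg := by linarith
  have hπ := Real.pi_pos
  have hχ1 : χ ≠ 1 := Lemma31.ne_one_of_isPrimitive χ hD2 hprim
  -- `x ≥ T ≥ 1`
  have hx1 : 1 ≤ x := by
    refine le_trans ?_ hxT
    have : (0 : ℝ) ≤ Lg ^ (11 / 10 : ℝ) := by positivity
    calc (1 : ℝ) = Real.exp 0 := (Real.exp_zero).symm
      _ ≤ Real.exp (Lg ^ (11 / 10 : ℝ)) := Real.exp_le_exp.2 this
  have hx0 : 0 < x := by linarith
  -- `‖δ‖ ≤ 1`
  have hδ1 : ‖δ‖ ≤ 1 := by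
    refine hδ.trans ?_
    rw [div_le_one (by positivity)]
    have h9 : Lg ^ 8 ≤ Lg ^ 9 := by
      calc Lg ^ 8 = Lg ^ 8 * 1 := (mul_one _).symm
        _ ≤ Lg ^ 8 * Lg := by gcongr; linarith
        _ = Lg ^ 9 := by ring
    nlinarith
  set η : ℝ := 1 / Lg with hηdef
  have hη0 : 0 < η := by positivity
  have hη2 : η ≤ 1 / 2 := by rw [hηdef, div_le_div_iff₀ hL0 (by norm_num)]; linarith
  -- the line shift across the double pole at `0`
  have hstrip := Literature.Analysis.Complex.integral_vertical_sub_eq_sum_of_poles_dslope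
    (F := G χ δ x) (σ₁ := -η) (κ := 1) (by linarith) ({0} : Finset ℂ) (fun _ => 1)
    (fun _ => phi χ δ x) univ isOpen_univ (subset_univ _)
    (fun p hp => by
      rw [Finset.mem_singleton] at hp; subst hp
      simp only [Complex.zero_re]; exact ⟨by linarith, one_pos⟩)
    (by
      rw [Finset.coe_singleton]
      intro z hz
      have hz0 : z ≠ 0 := by simpa using hz
      exact (differentiableAt_G χ hχ1 δ hx0 hz0).differentiableWithinAt)
    (fun p hp => by
      rw [Finset.mem_singleton] at hp
      subst hp
      exact ⟨univ, univ_mem, (differentiable_phi χ hχ1 δ hx0).differentiableOn,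
        fun z _ _ => G_eq_phi_div χ δ x z⟩)
    (integrable_G_right χ hχ1 hδre hx0)
    (integrable_G_left χ hL hχ1 hδre hδ1 hx0)
    (G_horizontal_decay χ hχ1 hδre hδ1 hx1 hη2)
  rw [Finset.sum_singleton, residue_eq χ hχ1 δ hx0] at hstrip
  -- Perron
  have hperron := sum_eq_integral χ hδre hx0
  have e1 : (∫ t : ℝ, G χ δ x (((1 : ℝ) : ℂ) + t * I)) = ∫ t : ℝ, G χ δ x (1 + t * I) := by
    norm_num
  rw [e1] at hstrip
  set Ileft := ∫ t : ℝ, G χ δ x ((((-η : ℝ)) : ℂ) + t * I) with hIleft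
  set R := (Real.log x : ℂ) * χ.LFunction (1 + δ) + deriv χ.LFunction (1 + δ) with hR
  have hint : (∫ t : ℝ, G χ δ x (1 + t * I)) = Ileft + 2 * π * R := by
    rw [← hstrip]; ring
  have hπ0 : (π : ℂ) ≠ 0 := by exact_mod_cast hπ.ne'
  have hS : (∑ m ∈ Finset.Ioc 0 ⌊x⌋₊, twist χ δ m * (Real.log (x / m) : ℂ)) =
      (1 / (2 * π) : ℂ) * Ileft + R := by
    rw [hperron, hint, mul_add]
    congr 1
    field_simp
  rw [hS, show (1 / (2 * π) : ℂ) * Ileft + R - deriv χ.LFunction 1 * (1 + δ * Real.log x) =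
    (1 / (2 * π) : ℂ) * Ileft + (R - deriv χ.LFunction 1 * (1 + δ * Real.log x)) by ring]
  -- the two error terms
  have hres := norm_residue_sub_main_le χ hprim hL hA hK0 hK hδ hx1 hxP
  have hleft := norm_integral_G_left_le χ hL hχ1 hδre hδ1 hx0
  have hxfac := rpow_neg_inv_log_mul_le hL hxT
  have hnorm2π : ‖(1 / (2 * π) : ℂ)‖ = 1 / (2 * π) := by
    rw [norm_div, norm_one, norm_mul, Complex.norm_real, Real.norm_eq_abs, abs_of_pos hπ]
    norm_num
  have hI0 := I0_nonneg
  calc ‖(1 / (2 * π) : ℂ) * Ileft + (R - deriv χ.LFunction 1 * (1 + δ * Real.log x))‖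
      ≤ ‖(1 / (2 * π) : ℂ) * Ileft‖ + ‖R - deriv χ.LFunction 1 * (1 + δ * Real.log x)‖ :=
        norm_add_le _ _
    _ ≤ 1 / (2 * π) * (x ^ (-(1 / Lg)) * (4 / 9 * Real.exp 1 * Lg ^ 3) * I0) +
        ((1 + 16 * Real.exp (9 / 2) * π ^ 2 * K ^ 2) + 64 * Real.exp (9 / 2) * (K + 1) * π) /
          Lg ^ 6 := by
        rw [norm_mul, hnorm2π]
        exact add_le_add (mul_le_mul_of_nonneg_left hleft (by positivity)) hres
    _ = 1 / (2 * π) * (4 / 9 * Real.exp 1 * I0) * (x ^ (-(1 / Lg)) * Lg ^ 3) +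
        ((1 + 16 * Real.exp (9 / 2) * π ^ 2 * K ^ 2) + 64 * Real.exp (9 / 2) * (K + 1) * π) /
          Lg ^ 6 := by ring
    _ ≤ 1 / (2 * π) * (4 / 9 * Real.exp 1 * I0) * ((Nat.factorial 90 : ℝ) / Lg ^ 6) +
        ((1 + 16 * Real.exp (9 / 2) * π ^ 2 * K ^ 2) + 64 * Real.exp (9 / 2) * (K + 1) * π) /
          Lg ^ 6 := by
        gcongr
    _ = C82 K / Lg ^ 6 := by rw [C82]; ring


omit [NeZero q] in
/-- The printed summand against the twisted coefficient: for `m ≥ 1`, `x > 0`,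
`χ(m) m^{β−1} (x/m)^{β′} log(x/m) = x^{β′} · a(m) log(x/m)` with `δ = β′ − β`, `x^{β′} = e^{β′ log x}`.
[folklore] -/
theorem summand_eq (β β' : ℂ) {x : ℝ} (hx : 0 < x) {m : ℕ} (hm : m ≠ 0) :
    χ (m : ZMod q) * (m : ℂ) ^ (β - 1) * (((x / m : ℝ)) : ℂ) ^ β' * (Real.log (x / m) : ℂ) =
      cexp (β' * (Real.log x : ℂ)) * (twist χ (β' - β) m * (Real.log (x / m) : ℂ)) := by
  have hm0 : (0 : ℝ) < m := by exact_mod_cast Nat.pos_of_ne_zero hm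
  have hmC : (m : ℂ) ≠ 0 := by exact_mod_cast hm
  have hxm : (0 : ℝ) < x / m := div_pos hx hm0
  have hxmC : (((x / m : ℝ)) : ℂ) ≠ 0 := by exact_mod_cast hxm.ne'
  simp only [twist]
  rw [Complex.cpow_def_of_ne_zero hmC, Complex.cpow_def_of_ne_zero hmC,
    Complex.cpow_def_of_ne_zero hxmC, ← Complex.ofReal_log hxm.le, ← Complex.natCast_log]
  have e : cexp ((Real.log m : ℂ) * (β - 1)) * cexp ((Real.log (x / m) : ℂ) * β') =
      cexp (β' * (Real.log x : ℂ)) * cexp ((Real.log m : ℂ) * (-1 - (β' - β))) := by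
    rw [← Complex.exp_add, ← Complex.exp_add, Real.log_div hx.ne' hm0.ne']
    congr 1
    push_cast
    ring
  calc χ (m : ZMod q) * cexp ((Real.log m : ℂ) * (β - 1)) *
        cexp ((Real.log (x / m) : ℂ) * β') * (Real.log (x / m) : ℂ)
      = χ (m : ZMod q) * (cexp ((Real.log m : ℂ) * (β - 1)) *
          cexp ((Real.log (x / m) : ℂ) * β')) * (Real.log (x / m) : ℂ) := by ring
    _ = _ := by rw [e]; ring

omit [NeZero q] in
/-- `‖e^{β′ log x}‖ = 1` for `β′` purely imaginary. [folklore] -/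
theorem norm_cexp_imag_mul_log {β' : ℂ} (hβ' : β'.re = 0) (x : ℝ) :
    ‖cexp (β' * (Real.log x : ℂ))‖ = 1 := by
  rw [Complex.norm_exp]
  simp [Complex.mul_re, hβ']

/-- **Lemma 8.2 (general shifts).** For `χ` primitive mod `D`, `𝓛 = log D ≥ 3`,
(A) `‖L(1,χ)‖ ≤ 𝓛^{-2022}`, `K ≥ 0` with `8Kπ ≤ 𝓛⁸` ("`D` large in terms of `K`"), purely
imaginary shifts `β, β′` with `‖β‖, ‖β′‖ ≤ Kα` (`α = π𝓛^{-9}`, (2.10)), and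
`T = exp(𝓛^{1.1}) ≤ x ≤ P = exp(𝓛⁹)`:
`‖∑_{m ≤ x} χ(m) m^{β−1} (x/m)^{β′} log(x/m) − L′(1,χ) 𝔣(x)‖ ≤ C82(2K) 𝓛^{-6}`,
`𝔣(x) = (1 + (β′ − β) log x) x^{β′}` (`frakf β β′ (log x)` of `Section8MainTerms`).
[cite: Zhang2022LandauSiegel, §8, Lemma 8.2] -/
theorem lemma_8_2_general {D : ℕ} [NeZero D] (χ : DirichletCharacter ℂ D)
    (hprim : χ.IsPrimitive) (hL : 3 ≤ Real.log D) (hA : ‖χ.LFunction 1‖ ≤ 1 / Real.log D ^ 2022)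
    {K : ℝ} (hK0 : 0 ≤ K) (hK : 8 * K * π ≤ Real.log D ^ 8) {β β' : ℂ} (hβre : β.re = 0)
    (hβ're : β'.re = 0) (hβ : ‖β‖ ≤ K * π / Real.log D ^ 9) (hβ' : ‖β'‖ ≤ K * π / Real.log D ^ 9)
    {x : ℝ} (hxT : Real.exp (Real.log D ^ (11 / 10 : ℝ)) ≤ x) (hxP : x ≤ Real.exp (Real.log D ^ 9)) :
    ‖(∑ m ∈ Finset.Ioc 0 ⌊x⌋₊, χ (m : ZMod D) * (m : ℂ) ^ (β - 1) * (((x / m : ℝ)) : ℂ) ^ β' *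
        (Real.log (x / m) : ℂ)) - deriv χ.LFunction 1 * frakf β β' (Real.log x)‖ ≤
      C82 (2 * K) / Real.log D ^ 6 := by
  have hx0 : 0 < x := lt_of_lt_of_le (Real.exp_pos _) hxT
  set δ : ℂ := β' - β with hδdef
  have hδre : δ.re = 0 := by simp [hδdef, hβre, hβ're]
  have hδ : ‖δ‖ ≤ 2 * K * π / Real.log D ^ 9 := by
    calc ‖δ‖ ≤ ‖β'‖ + ‖β‖ := norm_sub_le _ _
      _ ≤ K * π / Real.log D ^ 9 + K * π / Real.log D ^ 9 := add_le_add hβ' hβ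
      _ = 2 * K * π / Real.log D ^ 9 := by ring
  have hcore := sum_twist_log_sub_main_le χ hprim hL hA (K := 2 * K) (by positivity)
    (by linarith) hδre hδ hxT hxP
  -- rewrite the printed sum and main term through `x^{β′}`
  have hsum : (∑ m ∈ Finset.Ioc 0 ⌊x⌋₊, χ (m : ZMod D) * (m : ℂ) ^ (β - 1) *
      (((x / m : ℝ)) : ℂ) ^ β' * (Real.log (x / m) : ℂ)) =
      cexp (β' * (Real.log x : ℂ)) *
        ∑ m ∈ Finset.Ioc 0 ⌊x⌋₊, twist χ δ m * (Real.log (x / m) : ℂ) := by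
    rw [Finset.mul_sum]
    refine Finset.sum_congr rfl fun m hm => ?_
    have hm0 : m ≠ 0 := Nat.pos_iff_ne_zero.1 (Finset.mem_Ioc.1 hm).1
    rw [hδdef]
    exact summand_eq χ β β' hx0 hm0
  have hmain : frakf β β' (Real.log x) =
      cexp (β' * (Real.log x : ℂ)) * (1 + δ * (Real.log x : ℂ)) := by
    rw [frakf, hδdef]; ring
  rw [hsum, hmain, ← mul_assoc, mul_comm (deriv χ.LFunction 1) (cexp _), mul_assoc, ← mul_sub,
    norm_mul, norm_cexp_imag_mul_log hβ're, one_mul]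
  exact hcore

/-! #### The printed shifts -/

/-- (2.13): `β₁ = iα(1 − 5c′α𝓛)`, `α = π𝓛^{-9}` (2.10), as a function of the constant `c′` of
§4 and of `𝓛 = log D`. [cite: Zhang2022LandauSiegel, (2.13)] -/
def beta1 (c L : ℝ) : ℂ := ((π / L ^ 9 * (1 - 5 * c * (π / L ^ 9) * L) : ℝ) : ℂ) * I

/-- (2.13): `β₂ = 2iα(1 + c′α𝓛)`. [cite: Zhang2022LandauSiegel, (2.13)] -/
def beta2 (c L : ℝ) : ℂ := ((2 * (π / L ^ 9) * (1 + c * (π / L ^ 9) * L) : ℝ) : ℂ) * I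

/-- (2.13): `β₃ = 3iα(1 − c′α𝓛)`. [cite: Zhang2022LandauSiegel, (2.13)] -/
def beta3 (c L : ℝ) : ℂ := ((3 * (π / L ^ 9) * (1 - c * (π / L ^ 9) * L) : ℝ) : ℂ) * I

omit [NeZero q] in
/-- `Re(r·i) = 0`. [folklore] -/
theorem re_ofReal_mul_I (r : ℝ) : ((r : ℂ) * I).re = 0 := by simp

omit [NeZero q] in
/-- `‖r·i‖ = |r|`. [folklore] -/
theorem norm_ofReal_mul_I (r : ℝ) : ‖(r : ℂ) * I‖ = |r| := by
  rw [norm_mul, Complex.norm_I, mul_one, Complex.norm_real, Real.norm_eq_abs]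

omit [NeZero q] in
/-- `απ𝓛 ≤ …`: `α𝓛 = π𝓛^{-8} ≤ 1` for `𝓛 ≥ 3`. [folklore] -/
theorem alpha_mul_L_le_one {L : ℝ} (hL : 3 ≤ L) : π / L ^ 9 * L ≤ 1 := by
  have hL0 : 0 < L := by linarith
  have h8 : (3 : ℝ) ^ 8 ≤ L ^ 8 := pow_le_pow_left₀ (by norm_num) hL 8
  rw [div_mul_eq_mul_div, div_le_one (by positivity)]
  calc π * L ≤ 4 * L := by nlinarith [Real.pi_le_four]
    _ ≤ L ^ 8 * L := by nlinarith
    _ = L ^ 9 := by ring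

omit [NeZero q] in
/-- The printed shifts are purely imaginary of size `≤ (3 + 5c′)α`. [cite: Zhang2022LandauSiegel,
(2.13), (2.22)] -/
theorem shifts_bound {c L : ℝ} (hc : 0 ≤ c) (hL : 3 ≤ L) :
    ∀ b ∈ ({beta1 c L, beta2 c L, beta3 c L, betaMain (3 / 2) (π / L ^ 9),
      betaMain (5 / 2) (π / L ^ 9)} : Set ℂ),
      b.re = 0 ∧ ‖b‖ ≤ (3 + 5 * c) * π / L ^ 9 := by
  have hL0 : 0 < L := by linarith
  set α : ℝ := π / L ^ 9 with hα
  have hα0 : 0 < α := by positivity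
  have hαL : α * L ≤ 1 := alpha_mul_L_le_one hL
  have hαL0 : 0 ≤ α * L := by positivity
  have hcαL : c * α * L ≤ c := by
    calc c * α * L = c * (α * L) := by ring
      _ ≤ c * 1 := mul_le_mul_of_nonneg_left hαL hc
      _ = c := mul_one c
  have hcαL0 : 0 ≤ c * α * L := by positivity
  have hK : (3 + 5 * c) * π / L ^ 9 = (3 + 5 * c) * α := by rw [hα]; ring
  intro b hb
  simp only [Set.mem_insert_iff, Set.mem_singleton_iff] at hb
  rw [hK]
  rcases hb with rfl | rfl | rfl | rfl | rfl
  · refine ⟨re_ofReal_mul_I _, ?_⟩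
    rw [beta1, norm_ofReal_mul_I, ← hα, abs_mul, abs_of_pos hα0]
    have : |1 - 5 * c * α * L| ≤ 1 + 5 * c := by
      rw [abs_le]; constructor <;> nlinarith
    nlinarith
  · refine ⟨re_ofReal_mul_I _, ?_⟩
    rw [beta2, norm_ofReal_mul_I, ← hα, abs_of_nonneg (by positivity)]
    nlinarith
  · refine ⟨re_ofReal_mul_I _, ?_⟩
    rw [beta3, norm_ofReal_mul_I, ← hα, abs_mul, abs_of_pos (by positivity : (0 : ℝ) < 3 * α)]
    have : |1 - c * α * L| ≤ 1 + c := by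
      rw [abs_le]; constructor <;> nlinarith
    nlinarith
  · refine ⟨by simp [betaMain], ?_⟩
    have h32 : |((3 / 2 : ℚ) : ℝ)| = 3 / 2 := by norm_num
    rw [norm_betaMain, h32, abs_of_pos hα0]
    nlinarith
  · refine ⟨by simp [betaMain], ?_⟩
    have h52 : |((5 / 2 : ℚ) : ℝ)| = 5 / 2 := by norm_num
    rw [norm_betaMain, h52, abs_of_pos hα0]
    nlinarith

/-- **Zhang (2022), Lemma 8.2, as printed.** Fix the constant `c′ ≥ 0` of (2.13). There is
`C = C(c′)` such that for every primitive `χ` mod `D` with `𝓛 = log D ≥ 3` and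
`8(3 + 5c′)π ≤ 𝓛⁸` (i.e. `D ≥ D₀(c′)`), under (A) `‖L(1,χ)‖ ≤ 𝓛^{-2022}`, for every
`β_j ∈ {β₁, β₂, β₃}` ((2.13)), `β_μ ∈ {β₆, β₇} = {3iα/2, 5iα/2}` ((2.22)) and `T ≤ x ≤ P`
(`T = exp 𝓛^{1.1}`, `P = exp 𝓛⁹`):
`∑_{m<x} χ(m) m^{-(1−β_j)} (x/m)^{β_μ} log(x/m) = L′(1,χ) 𝔣_{jμ}(x) + O(𝓛^{-6})`,
`𝔣_{jμ}(x) = (1 + (β_μ − β_j) log x) x^{β_μ}` — precisely, the norm of the difference is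
`≤ C 𝓛^{-6}`. (The sum over `m ≤ x` equals the printed `∑_{m<x}`: the term `m = x` carries
`log(x/m) = 0`.) [cite: Zhang2022LandauSiegel, §8, Lemma 8.2] -/
theorem lemma_8_2 {c' : ℝ} (hc' : 0 ≤ c') : ∃ C : ℝ, ∀ (D : ℕ) [NeZero D]
    (χ : DirichletCharacter ℂ D), χ.IsPrimitive → 3 ≤ Real.log D →
    ‖χ.LFunction 1‖ ≤ 1 / Real.log D ^ 2022 → 8 * (3 + 5 * c') * π ≤ Real.log D ^ 8 →
    ∀ βj ∈ ({beta1 c' (Real.log D), beta2 c' (Real.log D), beta3 c' (Real.log D)} : Set ℂ),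
    ∀ βμ ∈ ({betaMain (3 / 2) (π / Real.log D ^ 9), betaMain (5 / 2) (π / Real.log D ^ 9)} : Set ℂ),
    ∀ x : ℝ, Real.exp (Real.log D ^ (11 / 10 : ℝ)) ≤ x → x ≤ Real.exp (Real.log D ^ 9) →
    ‖(∑ m ∈ Finset.Ioc 0 ⌊x⌋₊, χ (m : ZMod D) * (m : ℂ) ^ (βj - 1) * (((x / m : ℝ)) : ℂ) ^ βμ *
        (Real.log (x / m) : ℂ)) - deriv χ.LFunction 1 * frakf βj βμ (Real.log x)‖ ≤
      C / Real.log D ^ 6 := by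
  refine ⟨C82 (2 * (3 + 5 * c')), fun D _ χ hprim hL hA hD βj hβj βμ hβμ x hxT hxP => ?_⟩
  have hall := shifts_bound hc' hL
  have hj := hall βj (by
    simp only [Set.mem_insert_iff, Set.mem_singleton_iff] at hβj ⊢; tauto)
  have hμ := hall βμ (by
    simp only [Set.mem_insert_iff, Set.mem_singleton_iff] at hβμ ⊢; tauto)
  exact lemma_8_2_general χ hprim hL hA (K := 3 + 5 * c') (by positivity) (by linarith)
    hj.1 hμ.1 hj.2 hμ.2 hxT hxP


/-! #### The form in which §8 consumes the lemma: the weights `ϰ_i` of (8.6) -/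

/-- The weight (8.6): `ϰ(n) = (1 − log n/log P₁)(P₁/n)^{β_μ}` for `n < P₁`, `0` otherwise
(`ϰ₁`: `P₁, β₆`; `ϰ₂`: `P₂, β₇`; `ϰ₃`: `P₃, β₆`). [cite: Zhang2022LandauSiegel, §8, (8.6)] -/
def varkappa (P₁ : ℝ) (βμ : ℂ) (n : ℕ) : ℂ :=
  if (n : ℝ) < P₁ then ((1 - Real.log n / Real.log P₁ : ℝ) : ℂ) * (((P₁ / n : ℝ)) : ℂ) ^ βμ else 0

omit [NeZero q] in
/-- With `x = P₁/k` and `m ≤ x`: `ϰ(km) = (log(x/m)/log P₁)·(x/m)^{β_μ}` (both sides vanish when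
`km = P₁`). [cite: Zhang2022LandauSiegel, §8, (8.6) and the display after Lemma 8.4
("By Lemma 8.2 with x = P₁/dr …")] -/
theorem varkappa_mul_eq {P₁ : ℝ} (hP₁ : 1 < P₁) (βμ : ℂ) {k m : ℕ} (hk : 1 ≤ k) (hm : 1 ≤ m)
    (hmx : (m : ℝ) ≤ P₁ / k) :
    varkappa P₁ βμ (k * m) =
      ((Real.log (P₁ / k / m) / Real.log P₁ : ℝ) : ℂ) * (((P₁ / k / m : ℝ)) : ℂ) ^ βμ := by
  have hk0 : (0 : ℝ) < k := by exact_mod_cast hk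
  have hm0 : (0 : ℝ) < m := by exact_mod_cast hm
  have hP0 : 0 < P₁ := by linarith
  have hlogP : 0 < Real.log P₁ := Real.log_pos hP₁
  have hkm : ((k * m : ℕ) : ℝ) = (k : ℝ) * m := by push_cast; ring
  have hle : (k : ℝ) * m ≤ P₁ := by
    have := mul_le_mul_of_nonneg_left hmx hk0.le
    rwa [mul_div_cancel₀ _ hk0.ne'] at this
  have hquot : P₁ / k / m = P₁ / ((k : ℝ) * m) := by rw [div_div]
  unfold varkappa
  rw [hkm]
  rcases hle.lt_or_eq with hlt | heq
  · rw [if_pos hlt, hquot]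
    congr 2
    rw [Real.log_div hP0.ne' (by positivity), Real.log_mul hk0.ne' hm0.ne']
    field_simp
  · rw [if_neg (by rw [heq]; exact lt_irrefl _), hquot, heq, div_self hP0.ne', Real.log_one,
      zero_div]
    simp

/-- **Lemma 8.2 as consumed in §8** [the display after Lemma 8.4]: "By Lemma 8.2 with `x = P₁/dr` …
`∑_m χ(m)ϰ₁(drm)/m^{1−β_j} = (L′(1,χ)/log P₁)·𝔣_{j6}(P₁/dr) + O(𝓛⁻¹⁵)` if `dr < P₁/T`"
(`log P₁ ≍ 𝓛⁹`, so `O(𝓛⁻⁶/log P₁) = O(𝓛⁻¹⁵)`). Here for any level `P₁ ≤ P = e^{𝓛⁹}`, any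
`k = dr ≥ 1` with `kT ≤ P₁`, and purely imaginary shifts `‖β_j‖, ‖β_μ‖ ≤ Kα` (`8Kπ ≤ 𝓛⁸`):
`‖∑_{m} χ(m)ϰ(km)m^{β_j−1} − (L′(1,χ)/log P₁)·𝔣(P₁/k)‖ ≤ C82(2K)/(𝓛⁶ log P₁)`.
[cite: Zhang2022LandauSiegel, §8, Lemma 8.2 and the display after Lemma 8.4] -/
theorem lemma_8_2_varkappa {D : ℕ} [NeZero D] (χ : DirichletCharacter ℂ D)
    (hprim : χ.IsPrimitive) (hL : 3 ≤ Real.log D) (hA : ‖χ.LFunction 1‖ ≤ 1 / Real.log D ^ 2022)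
    {K : ℝ} (hK0 : 0 ≤ K) (hK : 8 * K * π ≤ Real.log D ^ 8) {βj βμ : ℂ} (hβjre : βj.re = 0)
    (hβμre : βμ.re = 0) (hβj : ‖βj‖ ≤ K * π / Real.log D ^ 9) (hβμ : ‖βμ‖ ≤ K * π / Real.log D ^ 9)
    {P₁ : ℝ} (hP₁P : P₁ ≤ Real.exp (Real.log D ^ 9)) {k : ℕ} (hk : 1 ≤ k)
    (hkT : Real.exp (Real.log D ^ (11 / 10 : ℝ)) * k ≤ P₁) :
    ‖(∑ m ∈ Finset.Ioc 0 ⌊P₁ / k⌋₊, χ (m : ZMod D) * varkappa P₁ βμ (k * m) * (m : ℂ) ^ (βj - 1)) -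
        deriv χ.LFunction 1 / (Real.log P₁ : ℂ) * frakf βj βμ (Real.log (P₁ / k))‖ ≤
      C82 (2 * K) / (Real.log D ^ 6 * Real.log P₁) := by
  have hk0 : (0 : ℝ) < k := by exact_mod_cast hk
  have hT1 : 1 < Real.exp (Real.log D ^ (11 / 10 : ℝ)) := by
    have : (0 : ℝ) < Real.log D ^ (11 / 10 : ℝ) := Real.rpow_pos_of_pos (by linarith) _
    exact Real.one_lt_exp_iff.2 this
  have hT0 : 0 < Real.exp (Real.log D ^ (11 / 10 : ℝ)) := Real.exp_pos _
  set x : ℝ := P₁ / k with hxdef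
  have hxT : Real.exp (Real.log D ^ (11 / 10 : ℝ)) ≤ x := by
    rw [hxdef, le_div_iff₀ hk0]; exact hkT
  have hx1 : 1 < x := lt_of_lt_of_le hT1 hxT
  have hP₁1 : 1 < P₁ := by
    have h1 : (1 : ℝ) ≤ k := by exact_mod_cast hk
    have hP0 : 0 ≤ P₁ := le_trans (by positivity) hkT
    have : x ≤ P₁ := by rw [hxdef]; exact div_le_self hP0 h1
    linarith
  have hlogP : 0 < Real.log P₁ := Real.log_pos hP₁1
  have hxP : x ≤ Real.exp (Real.log D ^ 9) := by
    refine le_trans ?_ hP₁P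
    rw [hxdef]; exact div_le_self (by linarith) (by exact_mod_cast hk)
  have hgen := lemma_8_2_general χ hprim hL hA hK0 hK hβjre hβμre hβj hβμ hxT hxP
  -- the sum is `(1/log P₁)` times the sum of Lemma 8.2 at `x = P₁/k`
  have hsum : (∑ m ∈ Finset.Ioc 0 ⌊P₁ / k⌋₊, χ (m : ZMod D) * varkappa P₁ βμ (k * m) *
      (m : ℂ) ^ (βj - 1)) = (1 / (Real.log P₁ : ℂ)) *
      ∑ m ∈ Finset.Ioc 0 ⌊x⌋₊, χ (m : ZMod D) * (m : ℂ) ^ (βj - 1) * (((x / m : ℝ)) : ℂ) ^ βμ *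
        (Real.log (x / m) : ℂ) := by
    rw [← hxdef, Finset.mul_sum]
    refine Finset.sum_congr rfl fun m hm => ?_
    have hm1 : 1 ≤ m := (Finset.mem_Ioc.1 hm).1
    have hmx : (m : ℝ) ≤ x := by
      have := (Finset.mem_Ioc.1 hm).2
      exact le_trans (by exact_mod_cast this) (Nat.floor_le (by linarith))
    rw [varkappa_mul_eq hP₁1 βμ hk hm1 (by rwa [hxdef] at hmx), ← hxdef]
    push_cast
    field_simp
  have hlogC : (Real.log P₁ : ℂ) ≠ 0 := by exact_mod_cast hlogP.ne'
  rw [hsum, show (1 / (Real.log P₁ : ℂ)) * (∑ m ∈ Finset.Ioc 0 ⌊x⌋₊, χ (m : ZMod D) *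
      (m : ℂ) ^ (βj - 1) * (((x / m : ℝ)) : ℂ) ^ βμ * (Real.log (x / m) : ℂ)) -
      deriv χ.LFunction 1 / (Real.log P₁ : ℂ) * frakf βj βμ (Real.log x) =
      (1 / (Real.log P₁ : ℂ)) * ((∑ m ∈ Finset.Ioc 0 ⌊x⌋₊, χ (m : ZMod D) *
      (m : ℂ) ^ (βj - 1) * (((x / m : ℝ)) : ℂ) ^ βμ * (Real.log (x / m) : ℂ)) -
      deriv χ.LFunction 1 * frakf βj βμ (Real.log x)) by field_simp, norm_mul]
  have hn : ‖(1 / (Real.log P₁ : ℂ))‖ = 1 / Real.log P₁ := by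
    rw [norm_div, norm_one, Complex.norm_real, Real.norm_eq_abs, abs_of_pos hlogP]
  rw [hn, div_mul_eq_div_div, le_div_iff₀ hlogP]
  calc 1 / Real.log P₁ * ‖(∑ m ∈ Finset.Ioc 0 ⌊x⌋₊, χ (m : ZMod D) * (m : ℂ) ^ (βj - 1) *
        (((x / m : ℝ)) : ℂ) ^ βμ * (Real.log (x / m) : ℂ)) - deriv χ.LFunction 1 * frakf βj βμ
          (Real.log x)‖ * Real.log P₁
      = ‖(∑ m ∈ Finset.Ioc 0 ⌊x⌋₊, χ (m : ZMod D) * (m : ℂ) ^ (βj - 1) *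
        (((x / m : ℝ)) : ℂ) ^ βμ * (Real.log (x / m) : ℂ)) - deriv χ.LFunction 1 * frakf βj βμ
          (Real.log x)‖ := by field_simp
    _ ≤ C82 (2 * K) / Real.log D ^ 6 := hgen

/-- **The printed instance**: `∑_m χ(m)ϰ_i(drm)m^{β_j−1} = (L′(1,χ)/log P_i)𝔣_{jμ}(P_i/dr) + O(𝓛⁻⁶/log P_i)`
for `β_j ∈ {β₁,β₂,β₃}(c′)`, `β_μ ∈ {β₆,β₇}`, any level `P_i ≤ P` and `dr·T ≤ P_i` (with
`log P₁ = 0.504𝓛⁹`, `log P₂ = 0.5𝓛⁹ − 10𝓛^{1.1}` this is the printed `O(𝓛⁻¹⁵)`).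
[cite: Zhang2022LandauSiegel, §8, the display after Lemma 8.4] -/
theorem lemma_8_2_varkappa_printed {c' : ℝ} (hc' : 0 ≤ c') : ∃ C : ℝ, ∀ (D : ℕ) [NeZero D]
    (χ : DirichletCharacter ℂ D), χ.IsPrimitive → 3 ≤ Real.log D →
    ‖χ.LFunction 1‖ ≤ 1 / Real.log D ^ 2022 → 8 * (3 + 5 * c') * π ≤ Real.log D ^ 8 →
    ∀ βj ∈ ({beta1 c' (Real.log D), beta2 c' (Real.log D), beta3 c' (Real.log D)} : Set ℂ),
    ∀ βμ ∈ ({betaMain (3 / 2) (π / Real.log D ^ 9), betaMain (5 / 2) (π / Real.log D ^ 9)} : Set ℂ),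
    ∀ P₁ : ℝ, P₁ ≤ Real.exp (Real.log D ^ 9) → ∀ k : ℕ, 1 ≤ k →
    Real.exp (Real.log D ^ (11 / 10 : ℝ)) * k ≤ P₁ →
    ‖(∑ m ∈ Finset.Ioc 0 ⌊P₁ / k⌋₊, χ (m : ZMod D) * varkappa P₁ βμ (k * m) * (m : ℂ) ^ (βj - 1)) -
        deriv χ.LFunction 1 / (Real.log P₁ : ℂ) * frakf βj βμ (Real.log (P₁ / k))‖ ≤
      C / (Real.log D ^ 6 * Real.log P₁) := by
  refine ⟨C82 (2 * (3 + 5 * c')), fun D _ χ hprim hL hA hD βj hβj βμ hβμ P₁ hP k hk hkT => ?_⟩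
  have hall := shifts_bound hc' hL
  have hj := hall βj (by
    simp only [Set.mem_insert_iff, Set.mem_singleton_iff] at hβj ⊢; tauto)
  have hμ := hall βμ (by
    simp only [Set.mem_insert_iff, Set.mem_singleton_iff] at hβμ ⊢; tauto)
  exact lemma_8_2_varkappa χ hprim hL hA (K := 3 + 5 * c') (by positivity) (by linarith)
    hj.1 hμ.1 hj.2 hμ.2 hP hk hkT

end Assembly

end Literature.NumberTheory.LFunctions.Zhang2022.Lemma82
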